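/-
Copyright (c) 2026. All rights reserved.
Released under Apache 2.0 license as described in the file LICENSE.
-/
import Literature.MathematicalPhysics.QuantumFieldTheory.Balaban1983to89.B4Lemma22InterpBox
import Literature.MathematicalPhysics.QuantumFieldTheory.Balaban1983to89.B4Lemma22ZeroBoxLpLq

/-!
# B4 Lemma 2.2 (2.17): THE `η`-UNIFORM `L^p → L^q` BOUND FOR `G_k(□,Ã)` ON A BOX IN THE PRINTED PARALLELOGRAM
«1/p − 1/p₁ ≤ 1/q ≤ 1/p», `p₁ > dim`, FROM THE MULTISCALE PIECES OF `G_k(□)`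

This file closes the item left open by `B4Lemma22InterpBox` (its HONEST SCOPE (2)): the `η`-UNIFORMITY of the
constant `c₂` of (2.17) OFF THE DIAGONAL in the printed `η`-weighted norms.  [B4, Lemma 2.2] asserts (2.17)
«for 1 ≤ p, q ≤ ∞, satisfying the condition 1/p − 1/p₁ ≤ 1/q ≤ 1/p with p₁ > d» with «a constant c₂ depending on
d, p₁» only; in counting-measure norms on the fine box (`B4Lemma22LpStair.lpS`, `lpM`, mesh `η = L^{-k}`, `n = L^k`
sites per unit length, `vol = n^{d+1}` sites per unit cube) this is the bound `‖G_k(□,Ã)f‖_q ≤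
c·vol^{−(1/p−1/q)}‖f‖_p` with `c` independent of `k` — a DECAY in `η` of the counting-measure operator norm, which the
counting-measure closure `B4Lemma22InterpBox.zero_box_pq` (one lattice-unit constant for all pairs) does not give.

* §1 **ONE PIECE.**  An entry / row / column package `B4Lemma22ZeroBoxLpLq.PB T E R` (`|T| ≤ E`, rows and columns of
  `|T|` at most `R`) gives `‖|T|ψ‖_q ≤ R^{1−σ}E^σ‖ψ‖_p`, `σ = 1/p − 1/q ∈ [0,1)` (`kernel_pq_of_PB`: the diagonal
  Schur corner `B4Lemma22InterpBox.corner_diag` and the `ℓ¹ → ℓ^∞` corner `corner_sup_E`, interpolated by the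
  positive-kernel Riesz–Thorin theorem `B4Lemma22InterpBox.riesz_thorin_pos_sup`), and `(|T|ψ)(y) ≤
  R^{1−1/p}E^{1/p}‖ψ‖_p` (`kernel_psup_of_PB`, weighted power mean).  With the SCALED constants of a multiscale piece,
  `E = Γs^d/vol`, `R = Γ/s`, this is `Γ·s^{(d+1)σ−1}·vol^{−σ}` (`scaled_bound`, `B4Lemma22ZeroBoxLpLq.scaled_consts`).
  `multiscale` is the abstract summation `𝒢_k = 𝒢_1 + Σ_{j<k}(𝒢_{j+1} − 𝒢_j)` for a subadditive monotone functional
  with the running geometric bound (`B4Lemma22ZeroBoxLpLq.geom_step`).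
* §2 **THE ZERO-FIELD KERNELS WITH THE `η`-DECAY.**  The tree's multiscale expansion of `G_k(□)`
  (`B4Thm110ZeroBox.Gfine`; `Gfine_top_eq`: `𝒢_k = G_k(□) = gk`) comes with the SCALED PACKAGES of its pieces
  (`B4Lemma22ZeroBoxLpLq.pieces_PB`, kernel-checked: the start piece and the fluctuation pieces `𝒢_{j+1} − 𝒢_j` of
  the three kernels `T^{(m)}`, `m = 0, 1, 2` — `G`, `D^η_μG`, `GD^{η*}_μ` — have entries `≤ Γs_j^d/n^{d+1}`, rows and
  columns `≤ Γ/s_j`, `s_j = L^{k−j}`, ONE `Γ` for the whole window; this is the content of (2.34)/(2.40) in lattice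
  units).  For `p₁ > d + 1` and `σ ≤ 1/p₁` the piece exponent `(d+1)σ − 1 ≤ (d+1)/p₁ − 1 =: e₁ < 0`, so `s_j ≥ 1` gives
  `s_j^{(d+1)σ−1} ≤ s_j^{e₁} = ρ^{k−j}`, `ρ = L^{e₁} < 1`, and the pieces sum to `(Γ/(1−ρ) + 1)·vol^{−σ}`:
  `zero_box_kernel_pq` (`1 ≤ p ≤ q < ∞`, `1/p − 1/q ≤ 1/p₁`) and `zero_box_kernel_psup` (target `ℓ^∞`, `p ≥ p₁`,
  factor `vol^{−1/p}`) — uniformly in `k`, the box and the window.  This is the print's p. 583 computation: the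
  geometric series «where the constant c'₂ is built of c₀, Σ_{x∈Z^d}e^{−δ₀|x|}, Σ_{j=1}^∞(L^{−j})^{1−d/p₁}» (print's
  `d` = our `d + 1`; `(L^{−j})^{1−d/p₁} = ρ^j`), run directly at every pair of the parallelogram instead of at the
  corner `(1/p₁, 0)` followed by «The Riesz-Thorin Theorem gives us finally (2.17) for G_k(□) and for all p, q
  described in the figure» — per piece the two routes are the same interpolation (`kernel_pq_of_PB`).
* §3 **THE VECTOR LIFT** (`B4Lemma22LpLqTransfer.lpM_kron_le_pq`, `supN_kron_le_p`; `kerOf_zero_apply`,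
  `dk_mul_apply_eq_kerOf`): `zero_box_pq_eta`, `zero_box_psup_eta` — the zero-field pair
  `(G_k(□)⊗1, (D^η_μ⊗1)(G_k(□)⊗1))` with the factor `vol^{−σ}` (resp. `vol^{−1/p}`).
* §4 **(2.17) FOR `G_k(□,Ã)` WITH THE `η`-DECAY** through the reductions of `B4Lemma22LpLqTransfer`
  (`lemma22_17_pq_box`, `lemma22_17_psup_box`, `lemma22_17_pq_box_dual`, `lemma22_17_pq_stair`, which are
  homogeneous in the zero-field constant): members `G`, `D^η_{A₀,μ}G`, `D^η_{Ã,μ}G` on a box for all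
  `1 ≤ p ≤ q < ∞` with `1/p − 1/q ≤ 1/p₁` (`lemma22_17_pq_box_eta`), target `‖·‖_∞` for `p ≥ p₁`
  (`lemma22_17_psup_box_eta`), the third member `G(D^η_μ)ᵀ = GD^{η*}_μ` for `1 < p ≤ q < ∞` («Again by the duality
  argument»: the dual pair `(q',p')` lies in the same parallelogram, `conj_sub_eq`; `lemma22_17_pq_box_dual_eta`),
  and the staircase-contour version with everything but the printed smallness hypotheses discharged
  (`lemma22_17_pq_stair_eta`).
* §5 **THE PRINTED `η`-WEIGHTED NORMS.**  `lpW d ℓ k p Φ = vol^{−1/p}‖Φ‖_p = (Σ_x η^{d+1}|Φ(x)|^p)^{1/p}`; the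
  counting-measure bound with the factor `vol^{−(1/p−1/q)}` IS the weighted bound with an `η`-independent constant
  (`lpW_le_of_lpM`, `weight_identity`; `supN_le_lpW_of`).  Headline statements: `lemma22_17_weighted_box`
  (`‖Gf‖_{q,η} ≤ 2C‖f‖_{p,η}`, `‖D^η_{A₀,μ}Gf‖_{q,η} ≤ 2C‖f‖_{p,η}`, `‖D^η_{Ã,μ}Gf‖_{q,η} ≤ (1+ℓθ)2C‖f‖_{p,η}` for all
  `1 ≤ p ≤ q < ∞` of the parallelogram, ONE `C`, every `k ≥ 1`), `lemma22_17_weighted_box_sup` (the edge `q = ∞`,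
  `p ≥ p₁`: «the operators G_k(□), ∂^η_μG_k(□), G_k(□)∂^{η*}_μ are bounded operators from L^{p₁}(□) with p₁ > d to
  L^∞(□)», here for `G_k(□,Ã)` and its derivatives), `lemma22_17_weighted_box_dual` (third member, `1 < p`),
  `lemma22_17_weighted_stair` (staircase contours).
* §6 **THE THIRD MEMBER ON THE TWO REMAINING EDGES**: `p = 1 < q ≤ p₁'` (`lemma22_17_pq_box_dual_one_eta`,
  `lemma22_17_weighted_box_dual_one`: `‖G(D^η_μ)ᵀf‖_{q,η} ≤ 2C‖f‖_{1,η}`, from `zero_box_psup_eta` at the dual exponent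
  `q' ≥ p₁` through `B4Lemma22LpLqTransfer.lemma22_17_pq_box_dual_one`) and `q = ∞`, `p₁ ≤ p < ∞`
  (`lemma22_17_pq_box_dual_sup_eta`, `lemma22_17_weighted_box_dual_sup`: `‖G(D^η_μ)ᵀf‖_∞ ≤ 2C‖f‖_{p,η}`, from
  `zero_box_pq_eta` at `(1,p')` through `B4Lemma22LpLqTransfer.lemma22_17_pq_box_dual_sup`).  With §4–§6 every pair
  of the printed parallelogram with `p < ∞` is covered for all three members (`q < ∞` via `lpM`/`lpW`, `q = ∞` via
  `supN`); the remaining corner `p = q = ∞` carries no weight and is `B4Lemma22SupStair`.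

HONEST SCOPE.  (1) As in `B4Lemma22InterpBox`, the interpolation is the Riesz convexity theorem for operators
dominated by a nonnegative kernel, not the complex-interpolation theorem of the print's Ref. [6]; it suffices because
every bound of the lineage is a bound for the dominating kernel.  (2) `lpW` is OUR READING of the print's `L^p(□)`
norms on the `η`-lattice (the `η^{dim}`-weighted counting measure; the definition is in paper I of the series, not
restated in [B4]); it is the normalisation under which (2.41) reads «η2c₀O(1)η^{−d/p₁}‖f‖_{p₁}» and under which (2.16),
(2.17) can hold uniformly in `η`.  In counting measure the statements of §4 are unconditional and say exactly which
power of `η` the constant carries.  (3) Exponents are real and finite on the source side: `1 ≤ p ≤ q < ∞` with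
`1/p − 1/q ≤ 1/p₁` (§4, §5; third member `1 < p`), plus the edges `q = ∞`, `p₁ ≤ p < ∞` through `supN` (§4–§6)
and, for the third member, `p = 1 < q ≤ p₁'` (§6); the corner `p = q = ∞` is `B4Lemma22SupStair` (no weight, hence
`η`-uniform as it stands); a source exponent `p = ∞` with `q < ∞` does not occur in the parallelogram.  (4) Boxes
and the staircase contour system of `B4Lower18Regular` only — not the torus or a general region `Ω` (Lemma 2.2 is
stated for «a rectangular parallelepiped □»); (2.16) (the Hölder norms) is not
touched.  (5) The zero-field input is the tree's kernel-checked `B4Lemma22ZeroBoxLpLq.pieces_PB` (built on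
`B4Thm110ZeroBox`, `B4Thm110ZeroBoxDeriv`, `B4Lemma22ZeroBoxDerivDual`); nothing is cited as a fact, every hypothesis
is an explicit binder or a tree theorem, all declarations are kernel-checked with the standard axioms.

References: [B4] T. Balaban, Regularity and decay of lattice Green's functions, Comm. Math. Phys. 89 (1983) 571–597,
Lemma 2.2 (2.17) p. 578, proof pp. 579–583, esp. (2.40)–(2.41) p. 583 (bib key `Balaban1983RegularityDecay`).
Mathlib: `Real.inner_le_weight_mul_Lp_of_nonneg`, `Real.rpow_le_rpow_of_exponent_le`,
`Real.rpow_lt_one_of_one_lt_of_neg`.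
-/

namespace Literature.MathematicalPhysics.QuantumFieldTheory.Balaban1983to89.B4Lemma22EtaBox

open Finset Matrix
open scoped Kronecker
open Literature.MathematicalPhysics.QuantumFieldTheory.Balaban1983to89.B4GaugeCovariance
open Literature.MathematicalPhysics.QuantumFieldTheory.Balaban1983to89.B4Lower18Regular (e1 lsum baseEmb stairContour
  stairContour_end)
open Literature.MathematicalPhysics.QuantumFieldTheory.Balaban1983to89.B4Lemma21Region (siteNorm covDeriv)
open Literature.MathematicalPhysics.QuantumFieldTheory.Balaban1983to89.B4Reflection242 (nbrs boxDom)
open Literature.MathematicalPhysics.QuantumFieldTheory.Balaban1983to89.B4Lemma22Reduce231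
open Literature.MathematicalPhysics.QuantumFieldTheory.Balaban1983to89.B4Lemma22ReduceZero
open Literature.MathematicalPhysics.QuantumFieldTheory.Balaban1983to89.B4Lemma22LpStair
open Literature.MathematicalPhysics.QuantumFieldTheory.Balaban1983to89.B4Lemma22LpLqTransfer
open Literature.MathematicalPhysics.QuantumFieldTheory.Balaban1983to89.B4Lemma22InterpBox
open Literature.MathematicalPhysics.QuantumFieldTheory.Balaban1983to89.B4Lemma22ZeroBoxLpLq (PB kerOf kerOf_add
  pieces_PB scaled_consts sc_rpow geom_step)
open Literature.MathematicalPhysics.QuantumFieldTheory.Balaban1983to89.B4Thm110ZeroBox (Nf sc sc_pos one_le_sc Gfine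
  fineOp_top L_real_pos one_lt_L_real)
open Literature.MathematicalPhysics.QuantumFieldTheory.Balaban1983to89.B4Lemma22ZeroBoxDerivDual (fwd)

noncomputable section

/-! ## §1 ONE PIECE: `ℓ^p → ℓ^q` AND `ℓ^p → ℓ^∞` BOUNDS FROM AN ENTRY / ROW / COLUMN PACKAGE, AND THEIR SCALED FORM -/

section Piece

variable {X : Type*} [Fintype X]

/-- the `ℓ¹ → ℓ^∞` corner from an ENTRY bound: `|T| ≤ E` ⇒ `(|T|ψ)(y) ≤ E‖ψ‖₁` (`ψ ≥ 0`). [folklore] -/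
theorem corner_sup_E {T : X → X → ℝ} {E : ℝ} (hE : ∀ y x, |T y x| ≤ E) (ψ : X → ℝ) (hψ : ∀ x, 0 ≤ ψ x)
    (y : X) : ∑ x, |T y x| * ψ x ≤ E * lpS 1 ψ := by
  rw [lpS_one_eq hψ, mul_sum]
  exact sum_le_sum fun x _ => mul_le_mul_of_nonneg_right (hE y x) (hψ x)

/-- **ONE PIECE, `ℓ^p → ℓ^q` FOR `1 ≤ p ≤ q < ∞`**: an entry / row / column package `PB T E R` (`|T| ≤ E`, rows and
columns of `|T|` at most `R`) gives `‖|T|ψ‖_q ≤ R^{1−σ}E^{σ}‖ψ‖_p`, `σ = 1/p − 1/q` — the diagonal corner `(s,s)`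
(Schur, `B4Lemma22InterpBox.corner_diag`, constant `R`) and the corner `ℓ¹ → ℓ^∞` (`corner_sup_E`, constant `E`)
interpolated by the positive-kernel Riesz–Thorin theorem `B4Lemma22InterpBox.riesz_thorin_pos_sup` with `θ = σ`,
`s = (1−σ)q ≥ 1`. [folklore] -/
theorem kernel_pq_of_PB {T : X → X → ℝ} {E R : ℝ} (hT : PB T E R) (hE : 0 ≤ E) (hR : 0 ≤ R) {p q : ℝ}
    (hp : 1 ≤ p) (hpq : p ≤ q) (ψ : X → ℝ) (hψ : ∀ x, 0 ≤ ψ x) :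
    lpS q (fun y => ∑ x, |T y x| * ψ x) ≤ R ^ (1 - (p⁻¹ - q⁻¹)) * E ^ (p⁻¹ - q⁻¹) * lpS p ψ := by
  rcases eq_or_lt_of_le hpq with rfl | hlt
  · rw [sub_self, sub_zero, Real.rpow_one, Real.rpow_zero, mul_one]
    exact corner_diag (S := Matrix.of fun y x => T y x) hR hT.2.1 hT.2.2 hp ψ hψ
  · have hp0 : 0 < p := by linarith
    have hq0 : 0 < q := by linarith
    have hpi1 : p⁻¹ ≤ 1 := inv_le_one_of_one_le₀ hp
    have hqi0 : 0 < q⁻¹ := inv_pos.2 hq0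
    set t : ℝ := p⁻¹ - q⁻¹ with ht
    have ht0 : 0 < t := sub_pos.2 ((inv_lt_inv₀ hq0 hp0).2 hlt)
    have ht1 : t < 1 := by linarith
    have h1t : 0 < 1 - t := sub_pos.2 ht1
    set s : ℝ := (1 - t) * q with hs
    have hs1 : 1 ≤ s := by
      have h1 : s = q * (1 - p⁻¹) + q * q⁻¹ := by rw [hs, ht]; ring
      rw [h1, mul_inv_cancel₀ hq0.ne']
      nlinarith
    have hs0 : 0 < s := by linarith
    have hrel_q : q⁻¹ = (1 - t) * s⁻¹ := by
      rw [hs, mul_inv, ← mul_assoc, mul_inv_cancel₀ h1t.ne', one_mul]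
    have hrel_p : p⁻¹ = (1 - t) * s⁻¹ + t * (1 : ℝ)⁻¹ := by
      rw [← hrel_q, inv_one, mul_one, ht]
      ring
    exact riesz_thorin_pos_sup (K := fun y x => |T y x|) (fun _ _ => abs_nonneg _) hs0 hs0 one_pos hR hE
      ht0 ht1 hrel_p hrel_q (fun φ hφ => corner_diag (S := Matrix.of fun y x => T y x) hR hT.2.1 hT.2.2 hs1 φ hφ)
      (fun φ hφ => corner_sup_E hT.1 φ hφ) ψ hψ

/-- **ONE PIECE, `ℓ^p → ℓ^∞` FOR EVERY `p ≥ 1`**: `PB T E R` gives `(|T|ψ)(y) ≤ R^{1−1/p}E^{1/p}‖ψ‖_p` (weighted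
power mean `Real.inner_le_weight_mul_Lp_of_nonneg`: `Σ|T|ψ ≤ (Σ|T|)^{1−1/p}(Σ|T|ψ^p)^{1/p}`). [folklore] -/
theorem kernel_psup_of_PB {T : X → X → ℝ} {E R : ℝ} (hT : PB T E R) (hE : 0 ≤ E) (hR : 0 ≤ R) {p : ℝ}
    (hp : 1 ≤ p) (ψ : X → ℝ) (hψ : ∀ x, 0 ≤ ψ x) (y : X) :
    ∑ x, |T y x| * ψ x ≤ R ^ (1 - p⁻¹) * E ^ p⁻¹ * lpS p ψ := by
  have hp0 : 0 < p := by linarith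
  have hw := Real.inner_le_weight_mul_Lp_of_nonneg (univ : Finset X) hp (fun x => |T y x|) ψ
    (fun _ => abs_nonneg _) hψ
  have hS0 : 0 ≤ ∑ x, |T y x| := sum_nonneg fun _ _ => abs_nonneg _
  have hT0 : 0 ≤ ∑ x, |T y x| * ψ x ^ p :=
    sum_nonneg fun x _ => mul_nonneg (abs_nonneg _) (Real.rpow_nonneg (hψ x) _)
  have hP0 : 0 ≤ ∑ x, ψ x ^ p := sum_nonneg fun x _ => Real.rpow_nonneg (hψ x) _
  have h1 : (∑ x, |T y x|) ^ (1 - p⁻¹) ≤ R ^ (1 - p⁻¹) :=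
    Real.rpow_le_rpow hS0 (hT.2.1 y) (sub_nonneg.2 (inv_le_one_of_one_le₀ hp))
  have h2 : (∑ x, |T y x| * ψ x ^ p) ^ p⁻¹ ≤ (E * ∑ x, ψ x ^ p) ^ p⁻¹ :=
    Real.rpow_le_rpow hT0 (by
      rw [mul_sum]
      exact sum_le_sum fun x _ => mul_le_mul_of_nonneg_right (hT.1 y x) (Real.rpow_nonneg (hψ x) _))
      (inv_nonneg.2 hp0.le)
  calc ∑ x, |T y x| * ψ x ≤ (∑ x, |T y x|) ^ (1 - p⁻¹) * (∑ x, |T y x| * ψ x ^ p) ^ p⁻¹ := hw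
    _ ≤ R ^ (1 - p⁻¹) * (E * ∑ x, ψ x ^ p) ^ p⁻¹ :=
        mul_le_mul h1 h2 (Real.rpow_nonneg hT0 _) (Real.rpow_nonneg hR _)
    _ = R ^ (1 - p⁻¹) * E ^ p⁻¹ * lpS p ψ := by
        rw [Real.mul_rpow hE hP0, ← mul_assoc, lpS_eq_of_nonneg hψ]

/-- the scaled constants: `(Γ/γ)^{1−σ}·(Γγ^d/N)^σ = Γ·γ^{(d+1)σ−1}·N^{−σ}` (`B4Lemma22ZeroBoxLpLq.scaled_consts`).
[folklore] -/
theorem scaled_bound {Γ γ N : ℝ} (hΓ : 0 ≤ Γ) (hγ : 0 < γ) (hN : 0 < N) (σ : ℝ) (d : ℕ) :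
    (Γ / γ) ^ (1 - σ) * (Γ * γ ^ d / N) ^ σ = Γ * γ ^ (((d : ℝ) + 1) * σ - 1) * (N ^ σ)⁻¹ := by
  rw [Real.div_rpow (mul_nonneg hΓ (pow_nonneg hγ.le _)) hN.le, div_eq_mul_inv ((Γ * γ ^ d) ^ σ), ← mul_assoc,
    mul_comm ((Γ / γ) ^ (1 - σ)) ((Γ * γ ^ d) ^ σ), scaled_consts hΓ hγ d]

/-- **THE MULTISCALE SUM** (abstract): a functional `ν` on nonnegative functions that is subadditive and monotone
(`ν = ‖·‖_q`, or evaluation at a site), kernels `T_1, …, T_k` whose dominated actions satisfy `ν(|T_1|ψ) ≤ Γρ^{k−1}W`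
and `ν(|T_{j+1} − T_j|ψ) ≤ Γρ^{k−j}W` (`1 ≤ j < k`, `0 < ρ < 1`) give `ν(|T_k|ψ) ≤ Γ/(1−ρ)·W` — by induction on `j`
with the running bound `Γρ^{k−j}/(1−ρ)` (`B4Lemma22ZeroBoxLpLq.geom_step`), i.e. the convergent geometric series
«Σ_{j=1}^∞(L^{−j})^{1−d/p₁}» of p. 583. [folklore] -/
theorem multiscale {ν : (X → ℝ) → ℝ}
    (hadd : ∀ f g : X → ℝ, (∀ x, 0 ≤ f x) → (∀ x, 0 ≤ g x) → ν (fun x => f x + g x) ≤ ν f + ν g)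
    (hmono : ∀ f g : X → ℝ, (∀ x, 0 ≤ f x) → (∀ x, f x ≤ g x) → ν f ≤ ν g)
    (T : ℕ → X → X → ℝ) {ψ : X → ℝ} (hψ : ∀ x, 0 ≤ ψ x) {Γ ρ W : ℝ} (hΓ : 0 ≤ Γ) (hρ0 : 0 < ρ)
    (hρ1 : ρ < 1) (hW : 0 ≤ W) {k : ℕ} (hk : 1 ≤ k)
    (h1 : ν (fun y => ∑ x, |T 1 y x| * ψ x) ≤ Γ * ρ ^ (k - 1) * W)
    (hj : ∀ j, 1 ≤ j → j + 1 ≤ k →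
      ν (fun y => ∑ x, |T (j + 1) y x - T j y x| * ψ x) ≤ Γ * ρ ^ (k - j) * W) :
    ν (fun y => ∑ x, |T k y x| * ψ x) ≤ Γ / (1 - ρ) * W := by
  have h1ρ : 0 < 1 - ρ := by linarith
  have claim : ∀ j, 1 ≤ j → j ≤ k →
      ν (fun y => ∑ x, |T j y x| * ψ x) ≤ Γ / (1 - ρ) * ρ ^ (k - j) * W := by
    intro j hj1
    induction j, hj1 using Nat.le_induction with
    | base =>
        intro _
        refine h1.trans (mul_le_mul_of_nonneg_right (mul_le_mul_of_nonneg_right ?_ (pow_nonneg hρ0.le _)) hW)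
        rw [le_div_iff₀ h1ρ]
        nlinarith
    | succ j hj1 ih =>
        intro hjk
        have hA : ∀ y, 0 ≤ ∑ x, |T j y x| * ψ x :=
          fun y => sum_nonneg fun x _ => mul_nonneg (abs_nonneg _) (hψ x)
        have hB : ∀ y, 0 ≤ ∑ x, |T (j + 1) y x - T j y x| * ψ x :=
          fun y => sum_nonneg fun x _ => mul_nonneg (abs_nonneg _) (hψ x)
        calc ν (fun y => ∑ x, |T (j + 1) y x| * ψ x)
            ≤ ν (fun y => (∑ x, |T j y x| * ψ x) + ∑ x, |T (j + 1) y x - T j y x| * ψ x) :=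
              hmono _ _ (fun y => sum_nonneg fun x _ => mul_nonneg (abs_nonneg _) (hψ x)) fun y => by
                rw [← sum_add_distrib]
                exact sum_le_sum fun x _ => by
                  rw [← add_mul]
                  refine mul_le_mul_of_nonneg_right ?_ (hψ x)
                  calc |T (j + 1) y x| = |T j y x + (T (j + 1) y x - T j y x)| := by rw [add_sub_cancel]
                    _ ≤ |T j y x| + |T (j + 1) y x - T j y x| := abs_add_le _ _
          _ ≤ ν (fun y => ∑ x, |T j y x| * ψ x) + ν (fun y => ∑ x, |T (j + 1) y x - T j y x| * ψ x) :=
              hadd _ _ hA hB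
          _ ≤ Γ / (1 - ρ) * ρ ^ (k - j) * W + Γ * ρ ^ (k - j) * W :=
              add_le_add (ih (by omega)) (hj j hj1 hjk)
          _ = (Γ / (1 - ρ) * ρ ^ (k - j) + Γ * ρ ^ (k - j)) * W := by ring
          _ ≤ Γ / (1 - ρ) * ρ ^ (k - (j + 1)) * W :=
              mul_le_mul_of_nonneg_right (geom_step hΓ hρ0 hρ1 hjk) hW
  have hfin := claim k hk le_rfl
  rwa [Nat.sub_self, pow_zero, mul_one] at hfin

end Piece

/-! ## §2 THE ZERO-FIELD KERNELS OF `G_k(□)` WITH THE `η`-DECAY `η^{(d+1)(1/p−1/q)}` -/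

section ZeroField

variable {d : ℕ}

/-- the number of `η`-lattice sites per unit cube, `vol = n^{d+1} = η^{−(d+1)}` (`n = L^k`, `η = L^{-k}`); the
printed `η`-weighted norms carry the weight `vol⁻¹` per site (§5). [folklore] -/
def vol (d ℓ k : ℕ) : ℝ := ((((ℓ + 1) ^ k : ℕ) : ℝ)) ^ (d + 1)

/-- `vol > 0`. [folklore] -/
theorem vol_pos (d ℓ k : ℕ) : 0 < vol d ℓ k := by
  unfold vol
  positivity

/-- `vol ≥ 1`. [folklore] -/
theorem one_le_vol (d ℓ k : ℕ) : 1 ≤ vol d ℓ k := by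
  unfold vol
  exact one_le_pow₀ (by exact_mod_cast Nat.one_le_pow _ _ (Nat.succ_pos ℓ))

/-- the top multiscale Green operator of `B4Thm110ZeroBox` IS the one-component propagator `G_k(□)` of this lineage:
`𝒢_k = fineOp_k⁻¹ = boxOpR(L^k, a_k, m², M)⁻¹ = gk` (`B4Thm110ZeroBox.fineOp_top`). [folklore] -/
theorem Gfine_top_eq (ℓ k : ℕ) (M : Fin (d + 1) → ℕ) (a m2 : ℝ) : Gfine ℓ k M k a m2 = gk d ℓ k a m2 M := by
  unfold Gfine
  rw [fineOp_top]

variable {N : Fin (d + 1) → ℕ}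

/-- the kernel `m = 0` is the matrix itself. [folklore] -/
theorem kerOf_zero_apply (n : ℕ) (μ : Fin (d + 1)) (T : Matrix ↥(boxDom N) ↥(boxDom N) ℝ) (y x : ↥(boxDom N)) :
    kerOf n 0 μ T y x = T y x := by
  simp [kerOf]

/-- the kernel `m = 1` is the forward difference quotient in the output variable. [folklore] -/
theorem kerOf_one_apply (n : ℕ) (μ : Fin (d + 1)) (T : Matrix ↥(boxDom N) ↥(boxDom N) ℝ) (y x : ↥(boxDom N)) :
    kerOf n 1 μ T y x = (n : ℝ) * (T (fwd N μ y) x - T y x) := by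
  simp [kerOf]

/-- the kernel `m = 1` of `G` is the matrix `D^η_μ G` (`B4Lemma22ReduceZero.fdiffM_mul_apply_fwd`). [folklore] -/
theorem dk_mul_apply_eq_kerOf (ℓ k : ℕ) (M : Fin (d + 1) → ℕ) (μ : Fin (d + 1))
    (G : Matrix ↥(Box d ℓ k M) ↥(Box d ℓ k M) ℝ) (y x : ↥(Box d ℓ k M)) :
    (dk d ℓ k M μ * G) y x = kerOf ((ℓ + 1) ^ k) 1 μ G y x := by
  rw [kerOf_one_apply]
  exact fdiffM_mul_apply_fwd μ G y x

/-- the differenced kernels of consecutive scales are the kernels of the fluctuation piece. [folklore] -/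
theorem kerOf_sub_apply (n : ℕ) (m : Fin 3) (μ : Fin (d + 1)) (A B : Matrix ↥(boxDom N) ↥(boxDom N) ℝ)
    (y x : ↥(boxDom N)) : kerOf n m μ A y x - kerOf n m μ B y x = kerOf n m μ (A - B) y x := by
  have h := kerOf_add n m μ (A - B) B y x
  rw [sub_add_cancel] at h
  linarith

/-- **THE ZERO-FIELD KERNELS WITH THE `η`-DECAY, TARGET `ℓ^q`**: for `p₁ > d + 1` there is ONE constant `c > 0`
(depending on `d, ℓ`, the window and `p₁`) such that for every `k ≥ 1`, `(a,m²)` in the window, every box, every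
kernel `m ∈ {0,1,2}` of `G_k(□)` (`G`, `D^η_μG`, `GD^{η*}_μ`), every axis, and every pair `1 ≤ p ≤ q < ∞` with
`1/p − 1/q ≤ 1/p₁`:  `‖|T^{(m)}|ψ‖_q ≤ c·(n^{d+1})^{−(1/p−1/q)}‖ψ‖_p` (`n = L^k = η^{-1}`, counting-measure norms,
`ψ ≥ 0`).  Per piece of the multiscale expansion `𝒢_k = 𝒢_1 + Σ_j(𝒢_{j+1} − 𝒢_j)`
(`B4Lemma22ZeroBoxLpLq.pieces_PB`: entries `≤ Γs_j^d/n^{d+1}`, rows and columns `≤ Γ/s_j`, `s_j = L^{k−j}`) the bound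
`kernel_pq_of_PB` is `Γs_j^{(d+1)σ−1}(n^{d+1})^{−σ}`, `σ = 1/p − 1/q`; since `s_j ≥ 1` and `(d+1)σ − 1 ≤ (d+1)/p₁ − 1
=: e₁ < 0`, `s_j^{(d+1)σ−1} ≤ s_j^{e₁} = ρ^{k−j}`, `ρ = L^{e₁} < 1`, and `multiscale` sums the series — the print's
«where the constant c'₂ is built of c₀, Σ_{x∈Z^d}e^{−δ₀|x|}, Σ_{j=1}^∞(L^{−j})^{1−d/p₁}» (its `d` is our `d + 1`).
[cite: Balaban1983RegularityDecay, Lemma 2.2 (2.17) p. 578; (2.40)–(2.41) p. 583] -/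
theorem zero_box_kernel_pq (d ℓ : ℕ) (hℓ : 1 ≤ ℓ) (amin aplus m2plus : ℝ) (ha : 0 < amin) {p₁ : ℝ}
    (hp₁ : (d : ℝ) + 1 < p₁) :
    ∃ c : ℝ, 0 < c ∧ ∀ (k : ℕ), 1 ≤ k → ∀ (a m2 : ℝ), amin ≤ a → a ≤ aplus → 0 ≤ m2 → m2 ≤ m2plus →
      ∀ (M : Fin (d + 1) → ℕ), (∀ i, 1 ≤ M i) → ∀ (m : Fin 3) (μ : Fin (d + 1)) (p q : ℝ), 1 ≤ p → p ≤ q →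
        p⁻¹ - q⁻¹ ≤ p₁⁻¹ → ∀ ψ : ↥(Box d ℓ k M) → ℝ, (∀ x, 0 ≤ ψ x) →
          lpS q (fun y => ∑ x, |kerOf ((ℓ + 1) ^ k) m μ (gk d ℓ k a m2 M) y x| * ψ x)
            ≤ c * (vol d ℓ k ^ (p⁻¹ - q⁻¹))⁻¹ * lpS p ψ := by
  obtain ⟨Γ, hΓ, hP⟩ := pieces_PB d ℓ hℓ amin aplus m2plus ha
  have hL1 : (1 : ℝ) < (ℓ : ℝ) + 1 := one_lt_L_real hℓ
  have hp₁0 : 0 < p₁ := by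
    have : (0 : ℝ) ≤ d := Nat.cast_nonneg d
    linarith
  set e₁ : ℝ := ((d : ℝ) + 1) * p₁⁻¹ - 1 with he₁
  have he₁0 : e₁ < 0 := by
    rw [he₁, sub_neg, ← div_eq_mul_inv, div_lt_one hp₁0]
    exact hp₁
  set ρ : ℝ := (((ℓ : ℝ) + 1)) ^ e₁ with hρ
  have hρ0 : 0 < ρ := Real.rpow_pos_of_pos (L_real_pos ℓ) e₁
  have hρ1 : ρ < 1 := Real.rpow_lt_one_of_one_lt_of_neg hL1 he₁0
  have h1ρ : 0 < 1 - ρ := by linarith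
  refine ⟨Γ / (1 - ρ) + 1, by positivity, ?_⟩
  intro k hk a m2 e1' e2 e3 e4 M hM m μ p q hp hpq hσ ψ hψ
  have hPk := hP k hk a m2 e1' e2 e3 e4 M hM m μ
  set N : ℝ := vol d ℓ k with hN
  have hN0 : 0 < N := vol_pos d ℓ k
  have hp0 : 0 < p := by linarith
  have hq0 : 0 < q := by linarith
  set σ : ℝ := p⁻¹ - q⁻¹ with hσdef
  have hσ0 : 0 ≤ σ := sub_nonneg.2 ((inv_le_inv₀ hq0 hp0).2 hpq)
  have he : ((d : ℝ) + 1) * σ - 1 ≤ e₁ :=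
    sub_le_sub_right (mul_le_mul_of_nonneg_left hσ (by positivity)) 1
  set W : ℝ := (N ^ σ)⁻¹ * lpS p ψ with hW
  have hW0 : 0 ≤ W := mul_nonneg (inv_nonneg.2 (Real.rpow_nonneg hN0.le _)) (lpS_nonneg _ _)
  -- one piece
  have piece : ∀ (j : ℕ) (T : ↥(Box d ℓ k M) → ↥(Box d ℓ k M) → ℝ),
      PB T (Γ * sc ℓ k j ^ d / N) (Γ / sc ℓ k j) →
        lpS q (fun y => ∑ x, |T y x| * ψ x) ≤ Γ * ρ ^ (k - j) * W := by
    intro j T hT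
    have hγ := sc_pos ℓ k j
    have hγ1 := one_le_sc ℓ k j
    have hE : 0 ≤ Γ * sc ℓ k j ^ d / N := by positivity
    have hR : 0 ≤ Γ / sc ℓ k j := by positivity
    calc lpS q (fun y => ∑ x, |T y x| * ψ x)
        ≤ (Γ / sc ℓ k j) ^ (1 - σ) * (Γ * sc ℓ k j ^ d / N) ^ σ * lpS p ψ :=
          kernel_pq_of_PB hT hE hR hp hpq ψ hψ
      _ = Γ * sc ℓ k j ^ (((d : ℝ) + 1) * σ - 1) * W := by
          rw [scaled_bound hΓ hγ hN0 σ d, hW]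
          ring
      _ ≤ Γ * sc ℓ k j ^ e₁ * W :=
          mul_le_mul_of_nonneg_right
            (mul_le_mul_of_nonneg_left (Real.rpow_le_rpow_of_exponent_le hγ1 he) hΓ) hW0
      _ = Γ * ρ ^ (k - j) * W := by rw [sc_rpow]
  -- the sum over the pieces
  have key := multiscale (ν := lpS q) (fun f g _ _ => lpS_add_le (hp.trans hpq) f g)
    (fun f g hf hfg => lpS_mono' hq0 hf hfg)
    (fun j => kerOf ((ℓ + 1) ^ k) m μ (Gfine ℓ k M j a m2)) hψ hΓ hρ0 hρ1 hW0 hk (piece 1 _ hPk.1)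
    (fun j hj1 hjk => by
      have h := piece j _ (hPk.2 j hj1 hjk)
      refine le_of_eq_of_le ?_ h
      congr 1
      ext y
      exact sum_congr rfl fun x _ => by rw [kerOf_sub_apply])
  rw [Gfine_top_eq] at key
  calc lpS q (fun y => ∑ x, |kerOf ((ℓ + 1) ^ k) m μ (gk d ℓ k a m2 M) y x| * ψ x)
      ≤ Γ / (1 - ρ) * W := key
    _ ≤ (Γ / (1 - ρ) + 1) * W := mul_le_mul_of_nonneg_right (by linarith) hW0
    _ = (Γ / (1 - ρ) + 1) * (N ^ σ)⁻¹ * lpS p ψ := by rw [hW, mul_assoc]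

/-- **THE ZERO-FIELD KERNELS WITH THE `η`-DECAY, TARGET `ℓ^∞`**: for `p₁ > d + 1`, ONE constant `c > 0` such that
for every `p ≥ p₁`, `(|T^{(m)}|ψ)(y) ≤ c·(n^{d+1})^{−1/p}‖ψ‖_p` uniformly — per piece `kernel_psup_of_PB` gives
`Γs_j^{(d+1)/p−1}(n^{d+1})^{−1/p}` and `(d+1)/p − 1 ≤ e₁`; the corner «the operators G_k(□), ∂^η_μG_k(□),
G_k(□)∂^{η*}_μ are bounded operators from L^{p₁}(□) with p₁ > d to L^∞(□)» ((2.40)–(2.41)) in its own scaling: with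
`‖ψ‖_{p,η} = η^{(d+1)/p}‖ψ‖_p` the bound reads `‖|T^{(m)}|ψ‖_∞ ≤ c‖ψ‖_{p,η}`.
[cite: Balaban1983RegularityDecay, (2.40)–(2.41) p. 583] -/
theorem zero_box_kernel_psup (d ℓ : ℕ) (hℓ : 1 ≤ ℓ) (amin aplus m2plus : ℝ) (ha : 0 < amin) {p₁ : ℝ}
    (hp₁ : (d : ℝ) + 1 < p₁) :
    ∃ c : ℝ, 0 < c ∧ ∀ (k : ℕ), 1 ≤ k → ∀ (a m2 : ℝ), amin ≤ a → a ≤ aplus → 0 ≤ m2 → m2 ≤ m2plus →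
      ∀ (M : Fin (d + 1) → ℕ), (∀ i, 1 ≤ M i) → ∀ (m : Fin 3) (μ : Fin (d + 1)) (p : ℝ), p₁ ≤ p →
        ∀ ψ : ↥(Box d ℓ k M) → ℝ, (∀ x, 0 ≤ ψ x) → ∀ y : ↥(Box d ℓ k M),
          ∑ x, |kerOf ((ℓ + 1) ^ k) m μ (gk d ℓ k a m2 M) y x| * ψ x
            ≤ c * (vol d ℓ k ^ p⁻¹)⁻¹ * lpS p ψ := by
  obtain ⟨Γ, hΓ, hP⟩ := pieces_PB d ℓ hℓ amin aplus m2plus ha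
  have hL1 : (1 : ℝ) < (ℓ : ℝ) + 1 := one_lt_L_real hℓ
  have hd1 : (1 : ℝ) ≤ (d : ℝ) + 1 := by
    have : (0 : ℝ) ≤ d := Nat.cast_nonneg d
    linarith
  have hp₁0 : 0 < p₁ := by linarith
  set e₁ : ℝ := ((d : ℝ) + 1) * p₁⁻¹ - 1 with he₁
  have he₁0 : e₁ < 0 := by
    rw [he₁, sub_neg, ← div_eq_mul_inv, div_lt_one hp₁0]
    exact hp₁
  set ρ : ℝ := (((ℓ : ℝ) + 1)) ^ e₁ with hρ
  have hρ0 : 0 < ρ := Real.rpow_pos_of_pos (L_real_pos ℓ) e₁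
  have hρ1 : ρ < 1 := Real.rpow_lt_one_of_one_lt_of_neg hL1 he₁0
  have h1ρ : 0 < 1 - ρ := by linarith
  refine ⟨Γ / (1 - ρ) + 1, by positivity, ?_⟩
  intro k hk a m2 e1' e2 e3 e4 M hM m μ p hp₁p ψ hψ y
  have hPk := hP k hk a m2 e1' e2 e3 e4 M hM m μ
  set N : ℝ := vol d ℓ k with hN
  have hN0 : 0 < N := vol_pos d ℓ k
  have hp1 : 1 ≤ p := by linarith
  have hp0 : 0 < p := by linarith
  have he : ((d : ℝ) + 1) * p⁻¹ - 1 ≤ e₁ :=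
    sub_le_sub_right (mul_le_mul_of_nonneg_left ((inv_le_inv₀ hp0 hp₁0).2 hp₁p) (by positivity)) 1
  set W : ℝ := (N ^ p⁻¹)⁻¹ * lpS p ψ with hW
  have hW0 : 0 ≤ W := mul_nonneg (inv_nonneg.2 (Real.rpow_nonneg hN0.le _)) (lpS_nonneg _ _)
  have piece : ∀ (j : ℕ) (T : ↥(Box d ℓ k M) → ↥(Box d ℓ k M) → ℝ),
      PB T (Γ * sc ℓ k j ^ d / N) (Γ / sc ℓ k j) → ∑ x, |T y x| * ψ x ≤ Γ * ρ ^ (k - j) * W := by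
    intro j T hT
    have hγ := sc_pos ℓ k j
    have hγ1 := one_le_sc ℓ k j
    have hE : 0 ≤ Γ * sc ℓ k j ^ d / N := by positivity
    have hR : 0 ≤ Γ / sc ℓ k j := by positivity
    calc ∑ x, |T y x| * ψ x ≤ (Γ / sc ℓ k j) ^ (1 - p⁻¹) * (Γ * sc ℓ k j ^ d / N) ^ p⁻¹ * lpS p ψ :=
          kernel_psup_of_PB hT hE hR hp1 ψ hψ y
      _ = Γ * sc ℓ k j ^ (((d : ℝ) + 1) * p⁻¹ - 1) * W := by
          rw [scaled_bound hΓ hγ hN0 p⁻¹ d, hW]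
          ring
      _ ≤ Γ * sc ℓ k j ^ e₁ * W :=
          mul_le_mul_of_nonneg_right
            (mul_le_mul_of_nonneg_left (Real.rpow_le_rpow_of_exponent_le hγ1 he) hΓ) hW0
      _ = Γ * ρ ^ (k - j) * W := by rw [sc_rpow]
  have key := multiscale (ν := fun f : ↥(Box d ℓ k M) → ℝ => f y) (fun f g _ _ => le_rfl)
    (fun f g _ hfg => hfg y)
    (fun j => kerOf ((ℓ + 1) ^ k) m μ (Gfine ℓ k M j a m2)) hψ hΓ hρ0 hρ1 hW0 hk (piece 1 _ hPk.1)
    (fun j hj1 hjk => by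
      have h := piece j _ (hPk.2 j hj1 hjk)
      refine le_of_eq_of_le ?_ h
      exact sum_congr rfl fun x _ => by rw [kerOf_sub_apply])
  rw [Gfine_top_eq] at key
  calc ∑ x, |kerOf ((ℓ + 1) ^ k) m μ (gk d ℓ k a m2 M) y x| * ψ x
      ≤ Γ / (1 - ρ) * W := key
    _ ≤ (Γ / (1 - ρ) + 1) * W := mul_le_mul_of_nonneg_right (by linarith) hW0
    _ = (Γ / (1 - ρ) + 1) * (N ^ p⁻¹)⁻¹ * lpS p ψ := by rw [hW, mul_assoc]

end ZeroField

/-! ## §3 THE VECTOR-FIELD LIFT: THE ZERO-FIELD PAIR `(G_k(□)⊗1, (D^η_μ⊗1)(G_k(□)⊗1))` WITH THE `η`-DECAY -/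

section Lift

variable {d : ℕ}

/-- **(2.17) AT `A = 0`, MEMBERS `n = 0, 1`, WITH THE `η`-DECAY, TARGET `ℓ^q`**: for `p₁ > d + 1`, one constant `c > 0`
such that for every `k ≥ 1`, `(a,m²)` in the window, every box and every pair `1 ≤ p ≤ q < ∞` with `1/p − 1/q ≤ 1/p₁`:
`‖(G_k(□)⊗1)Φ‖_q ≤ c·vol^{−(1/p−1/q)}‖Φ‖_p` and `‖(D^η_μ⊗1)(G_k(□)⊗1)Φ‖_q ≤ c·vol^{−(1/p−1/q)}‖Φ‖_p`
(`vol = η^{−(d+1)}`; `zero_box_kernel_pq` at `m = 0, 1`, lifted by `B4Lemma22LpLqTransfer.lpM_kron_le_pq`).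
[cite: Balaban1983RegularityDecay, Lemma 2.2 (2.17) p. 578; p. 583] -/
theorem zero_box_pq_eta (ι : Type) [Fintype ι] [DecidableEq ι] (d ℓ : ℕ) (hℓ : 1 ≤ ℓ)
    (amin aplus m2plus : ℝ) (ha : 0 < amin) {p₁ : ℝ} (hp₁ : (d : ℝ) + 1 < p₁) :
    ∃ c : ℝ, 0 < c ∧ ∀ (k : ℕ), 1 ≤ k → ∀ (a m2 : ℝ), amin ≤ a → a ≤ aplus → 0 ≤ m2 → m2 ≤ m2plus →
      ∀ (M : Fin (d + 1) → ℕ), (∀ i, 1 ≤ M i) → ∀ (p q : ℝ), 1 ≤ p → p ≤ q → p⁻¹ - q⁻¹ ≤ p₁⁻¹ →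
        (∀ Φ : ↥(Box d ℓ k M) × ι → ℝ,
            lpM q ((gk d ℓ k a m2 M ⊗ₖ (1 : Matrix ι ι ℝ)) *ᵥ Φ)
              ≤ c * (vol d ℓ k ^ (p⁻¹ - q⁻¹))⁻¹ * lpM p Φ) ∧
        (∀ (μ : Fin (d + 1)) (Φ : ↥(Box d ℓ k M) × ι → ℝ),
            lpM q ((dk d ℓ k M μ ⊗ₖ (1 : Matrix ι ι ℝ)) *ᵥ ((gk d ℓ k a m2 M ⊗ₖ (1 : Matrix ι ι ℝ)) *ᵥ Φ))
              ≤ c * (vol d ℓ k ^ (p⁻¹ - q⁻¹))⁻¹ * lpM p Φ) := by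
  obtain ⟨c, hc, h⟩ := zero_box_kernel_pq d ℓ hℓ amin aplus m2plus ha hp₁
  refine ⟨c, hc, ?_⟩
  intro k hk a m2 e1' e2 e3 e4 M hM p q hp hpq hσ
  have hq0 : 0 < q := by linarith
  refine ⟨fun Φ => ?_, fun μ Φ => ?_⟩
  · refine lpM_kron_le_pq hq0 (fun ψ hψ => ?_) Φ
    have key := h k hk a m2 e1' e2 e3 e4 M hM 0 0 p q hp hpq hσ ψ hψ
    have hker : (fun y => ∑ x, |kerOf ((ℓ + 1) ^ k) 0 0 (gk d ℓ k a m2 M) y x| * ψ x)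
        = fun y => ∑ x, |gk d ℓ k a m2 M y x| * ψ x := by
      funext y
      exact sum_congr rfl fun x _ => by rw [kerOf_zero_apply]
    rw [hker] at key
    exact key
  · rw [kron_one_mulVec_kron_one]
    refine lpM_kron_le_pq hq0 (fun ψ hψ => ?_) Φ
    have key := h k hk a m2 e1' e2 e3 e4 M hM 1 μ p q hp hpq hσ ψ hψ
    have hker : (fun y => ∑ x, |kerOf ((ℓ + 1) ^ k) 1 μ (gk d ℓ k a m2 M) y x| * ψ x)
        = fun y => ∑ x, |(dk d ℓ k M μ * gk d ℓ k a m2 M) y x| * ψ x := by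
      funext y
      exact sum_congr rfl fun x _ => by rw [dk_mul_apply_eq_kerOf]
    rw [hker] at key
    exact key

/-- **(2.17) AT `A = 0`, MEMBERS `n = 0, 1`, WITH THE `η`-DECAY, TARGET `ℓ^∞`, EVERY `p ≥ p₁ > d + 1`**:
`‖(G_k(□)⊗1)Φ‖_∞ ≤ c·vol^{−1/p}‖Φ‖_p`, `‖(D^η_μ⊗1)(G_k(□)⊗1)Φ‖_∞ ≤ c·vol^{−1/p}‖Φ‖_p` (`zero_box_kernel_psup`,
lifted by `B4Lemma22LpLqTransfer.supN_kron_le_p`) — (2.40)–(2.41) for `G_k(□)`, `∂^η_μG_k(□)` in their own scaling.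
[cite: Balaban1983RegularityDecay, (2.40)–(2.41) p. 583] -/
theorem zero_box_psup_eta (ι : Type) [Fintype ι] [DecidableEq ι] (d ℓ : ℕ) (hℓ : 1 ≤ ℓ)
    (amin aplus m2plus : ℝ) (ha : 0 < amin) {p₁ : ℝ} (hp₁ : (d : ℝ) + 1 < p₁) :
    ∃ c : ℝ, 0 < c ∧ ∀ (k : ℕ), 1 ≤ k → ∀ (a m2 : ℝ), amin ≤ a → a ≤ aplus → 0 ≤ m2 → m2 ≤ m2plus →
      ∀ (M : Fin (d + 1) → ℕ), (∀ i, 1 ≤ M i) → ∀ (p : ℝ), p₁ ≤ p →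
        (∀ Φ : ↥(Box d ℓ k M) × ι → ℝ,
            supN ((gk d ℓ k a m2 M ⊗ₖ (1 : Matrix ι ι ℝ)) *ᵥ Φ) ≤ c * (vol d ℓ k ^ p⁻¹)⁻¹ * lpM p Φ) ∧
        (∀ (μ : Fin (d + 1)) (Φ : ↥(Box d ℓ k M) × ι → ℝ),
            supN ((dk d ℓ k M μ ⊗ₖ (1 : Matrix ι ι ℝ)) *ᵥ ((gk d ℓ k a m2 M ⊗ₖ (1 : Matrix ι ι ℝ)) *ᵥ Φ))
              ≤ c * (vol d ℓ k ^ p⁻¹)⁻¹ * lpM p Φ) := by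
  obtain ⟨c, hc, h⟩ := zero_box_kernel_psup d ℓ hℓ amin aplus m2plus ha hp₁
  refine ⟨c, hc, ?_⟩
  intro k hk a m2 e1' e2 e3 e4 M hM p hp
  have hC : 0 ≤ c * (vol d ℓ k ^ p⁻¹)⁻¹ :=
    mul_nonneg hc.le (inv_nonneg.2 (Real.rpow_nonneg (vol_pos d ℓ k).le _))
  refine ⟨fun Φ => ?_, fun μ Φ => ?_⟩
  · refine supN_kron_le_p hC (fun ψ hψ y => ?_) Φ
    have key := h k hk a m2 e1' e2 e3 e4 M hM 0 0 p hp ψ hψ y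
    have hker : ∑ x, |kerOf ((ℓ + 1) ^ k) 0 0 (gk d ℓ k a m2 M) y x| * ψ x = ∑ x, |gk d ℓ k a m2 M y x| * ψ x :=
      sum_congr rfl fun x _ => by rw [kerOf_zero_apply]
    rw [hker] at key
    exact key
  · rw [kron_one_mulVec_kron_one]
    refine supN_kron_le_p hC (fun ψ hψ y => ?_) Φ
    have key := h k hk a m2 e1' e2 e3 e4 M hM 1 μ p hp ψ hψ y
    have hker : ∑ x, |kerOf ((ℓ + 1) ^ k) 1 μ (gk d ℓ k a m2 M) y x| * ψ x
        = ∑ x, |(dk d ℓ k M μ * gk d ℓ k a m2 M) y x| * ψ x :=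
      sum_congr rfl fun x _ => by rw [dk_mul_apply_eq_kerOf]
    rw [hker] at key
    exact key

end Lift

/-! ## §4 (2.17) FOR `G_k(□,Ã)` WITH THE `η`-DECAY: MEMBERS `G`, `D^η_μG` (BOTH CONVENTIONS), `GD^{η*}_μ`; BOXES AND
STAIRCASE CONTOURS -/

section Box

variable {ι : Type} [Fintype ι] [DecidableEq ι]

/-- for Hölder conjugate pairs the dual pair has the same `1/p − 1/q`: `1/q' − 1/p' = 1/p − 1/q`. [folklore] -/
theorem conj_sub_eq {p p' q q' : ℝ} (hpc : p.HolderConjugate p') (hqc : q.HolderConjugate q') :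
    q'⁻¹ - p'⁻¹ = p⁻¹ - q⁻¹ := by
  have hp := hpc.inv_add_inv_eq_inv
  have hq := hqc.inv_add_inv_eq_inv
  rw [inv_one] at hp hq
  linarith

/-- **(2.17) FOR `G_k(□,Ã)` ON A BOX WITH THE `η`-DECAY, MEMBERS `G`, `D^η_{A₀,μ}G`, `D^η_{Ã,μ}G`, ALL PAIRS
`1 ≤ p ≤ q < ∞` WITH `1/p − 1/q ≤ 1/p₁`** (`p₁ > d + 1`): with ONE constant `C` (of `zero_box_pq_eta`), uniformly over
the window, the box, the contour system and the background field under the printed smallness hypotheses (those of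
`B4Lemma22LpStair.lemma22_17_lp_box`): `‖Gf‖_q ≤ 2C·vol^{−(1/p−1/q)}‖f‖_p`,
`‖D^η_{A₀,μ}Gf‖_q ≤ 2C·vol^{−(1/p−1/q)}‖f‖_p`, `‖D^η_{Ã,μ}Gf‖_q ≤ (1+ℓθ)2C·vol^{−(1/p−1/q)}‖f‖_p` (counting-measure
norms; `vol = η^{−(d+1)}`) — equivalently (§5) `‖Gf‖_{q,η} ≤ 2C‖f‖_{p,η}` in the printed `η`-weighted norms, the
constant independent of `η`:
«and a constant c₂ depending on d, p₁, such that» (2.17) holds «for 1 ≤ p, q ≤ ∞, satisfying the condition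
1/p − 1/p₁ ≤ 1/q ≤ 1/p with p₁ > d».  `B4Lemma22LpLqTransfer.lemma22_17_pq_box` fed with `zero_box_pq_eta`.
[cite: Balaban1983RegularityDecay, Lemma 2.2 (2.17) p. 578; proof pp. 579–583] -/
theorem lemma22_17_pq_box_eta (F : OrthFlow ι) {ℓ₁ : ℝ} (hℓ₁ : 0 ≤ ℓ₁)
    (hLip : ∀ t (v : ι → ℝ), ((F.U t - 1) *ᵥ v) ⬝ᵥ ((F.U t - 1) *ᵥ v) ≤ (ℓ₁ * t) ^ 2 * (v ⬝ᵥ v))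
    (κ : ℝ) (d ℓ : ℕ) (hℓ : 1 ≤ ℓ) (amin aplus m2plus : ℝ) (ha : 0 < amin) {p₁ : ℝ} (hp₁ : (d : ℝ) + 1 < p₁) :
    ∃ c : ℝ, 0 < c ∧ ∃ C : ℝ, 0 < C ∧ ∀ (k : ℕ), 1 ≤ k → ∀ (a m2 : ℝ), amin ≤ a → a ≤ aplus → 0 ≤ m2 →
      m2 ≤ m2plus → ∀ (M : Fin (d + 1) → ℕ), (∀ i, 1 ≤ M i) →
      ∀ (emb : ↥(boxDom M) → ↥(Box d ℓ k M)) (Γ : ↥(boxDom M) → ↥(Box d ℓ k M) → List ↥(Box d ℓ k M)),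
        (∀ y x, blkWt ((ℓ + 1) ^ k) M (fun i => (ℓ + 1) ^ k * M i) y x ≠ 0 → pathEnd (emb y) (Γ y x) = x) →
      ∀ (A₀ : Fin (d + 1) → ℝ) (A' : ↥(Box d ℓ k M) → ↥(Box d ℓ k M) → ℝ) (θ θ' τ : ℝ),
        IsUnit (opA d F κ ℓ k a m2 M emb Γ (constBond A₀ Subtype.val + A')).det →
        0 ≤ θ → (∀ x y : ↥(Box d ℓ k M), y.1 ∈ nbrs x.1 → |κ * A' x y| ≤ θ / ((ℓ + 1) ^ k : ℕ)) →
        0 ≤ θ' → (∀ (x z y : ↥(Box d ℓ k M)) (μ : Fin (d + 1)), z.1 = x.1 + e1 μ → y.1 = z.1 + e1 μ →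
          |κ * (A' y z - A' z x)| ≤ θ' / (((ℓ + 1) ^ k : ℕ) : ℝ) ^ 2 ∧
          |κ * (A' x z - A' z y)| ≤ θ' / (((ℓ + 1) ^ k : ℕ) : ℝ) ^ 2) →
        (∀ (x y : ↥(Box d ℓ k M)) (μ : Fin (d + 1)), y.1 = x.1 + e1 μ →
          (x.1 - e1 μ ∉ Box d ℓ k M ∨ y.1 + e1 μ ∉ Box d ℓ k M) → A' x y = 0 ∧ A' y x = 0) →
        0 ≤ τ → (∀ y x, blkWt ((ℓ + 1) ^ k) M (fun i => (ℓ + 1) ^ k * M i) y x ≠ 0 →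
          |κ * lsum A' (emb y) (Γ y x)| ≤ τ) →
        ((d : ℝ) + 2) * c * (((d : ℝ) + 1) * ℓ₁ * (θ + θ') + ((d : ℝ) + 1) * ℓ₁ * θ
          + ((d : ℝ) + 1) * ℓ₁ ^ 2 * θ ^ 2 + B1.aSeq a ((ℓ : ℝ) + 1) k * (ℓ₁ * τ * (2 + ℓ₁ * τ))) ≤ 1 / 2 →
        ∀ (p q : ℝ), 1 ≤ p → p ≤ q → p⁻¹ - q⁻¹ ≤ p₁⁻¹ →
        ∀ f : ↥(Box d ℓ k M) × ι → ℝ,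
          lpM q (greenA d F κ ℓ k a m2 M emb Γ (constBond A₀ Subtype.val + A') *ᵥ f)
              ≤ 2 * (C * (vol d ℓ k ^ (p⁻¹ - q⁻¹))⁻¹) * lpM p f ∧
          (∀ μ : Fin (d + 1),
            lpM q (derivA0 d F κ ℓ k M A₀ μ
                *ᵥ (greenA d F κ ℓ k a m2 M emb Γ (constBond A₀ Subtype.val + A') *ᵥ f))
              ≤ 2 * (C * (vol d ℓ k ^ (p⁻¹ - q⁻¹))⁻¹) * lpM p f) ∧
          ∀ μ : Fin (d + 1),
            lpM q (derivA d F κ ℓ k M (constBond A₀ Subtype.val + A') μ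
                *ᵥ (greenA d F κ ℓ k a m2 M emb Γ (constBond A₀ Subtype.val + A') *ᵥ f))
              ≤ (1 + ℓ₁ * θ) * (2 * (C * (vol d ℓ k ^ (p⁻¹ - q⁻¹))⁻¹)) * lpM p f := by
  obtain ⟨c, hc, h⟩ := lemma22_17_pq_box F hℓ₁ hLip κ d ℓ hℓ amin aplus m2plus ha
  obtain ⟨C, hC, hz⟩ := zero_box_pq_eta ι d ℓ hℓ amin aplus m2plus ha hp₁
  refine ⟨c, hc, C, hC, ?_⟩
  intro k hk a m2 e1' e2 e3 e4 M hM emb Γ hend A₀ A' θ θ' τ hunit hθ hA' hθ' hder hbd hτ0 hτ hsm p q hp hpq hσ f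
  obtain ⟨hz0, hzD⟩ := hz k hk a m2 e1' e2 e3 e4 M hM p q hp hpq hσ
  have hC' : 0 ≤ C * (vol d ℓ k ^ (p⁻¹ - q⁻¹))⁻¹ :=
    mul_nonneg hC.le (inv_nonneg.2 (Real.rpow_nonneg (vol_pos d ℓ k).le _))
  exact h k hk a m2 e1' e2 e3 e4 M hM emb Γ hend A₀ A' θ θ' τ hunit hθ hA' hθ' hder hbd hτ0 hτ hsm p q hp
    (hp.trans hpq) _ hC' hz0 hzD f

/-- **(2.17) FOR `G_k(□,Ã)` ON A BOX WITH THE `η`-DECAY, MEMBERS `G`, `D^η_{A₀,μ}G`, `D^η_{Ã,μ}G`, TARGET `‖·‖_∞`,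
EVERY `p ≥ p₁ > d + 1`** (the edge `1/q = 0`, `0 ≤ 1/p ≤ 1/p₁` of the parallelogram): `‖Gf‖_∞ ≤ 2C·vol^{−1/p}‖f‖_p`,
`‖D^η_{A₀,μ}Gf‖_∞ ≤ 2C·vol^{−1/p}‖f‖_p`, `‖D^η_{Ã,μ}Gf‖_∞ ≤ (1+ℓθ)2C·vol^{−1/p}‖f‖_p`, i.e. `‖Gf‖_∞ ≤ 2C‖f‖_{p,η}`:
the corner «the operators G_k(□), ∂^η_μG_k(□), G_k(□)∂^{η*}_μ are bounded operators from L^{p₁}(□) with p₁ > d to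
L^∞(□)» transported to `G_k(□,Ã)`.  `B4Lemma22LpLqTransfer.lemma22_17_psup_box` fed with `zero_box_psup_eta`.
[cite: Balaban1983RegularityDecay, Lemma 2.2 (2.17) p. 578; (2.40)–(2.41) p. 583] -/
theorem lemma22_17_psup_box_eta (F : OrthFlow ι) {ℓ₁ : ℝ} (hℓ₁ : 0 ≤ ℓ₁)
    (hLip : ∀ t (v : ι → ℝ), ((F.U t - 1) *ᵥ v) ⬝ᵥ ((F.U t - 1) *ᵥ v) ≤ (ℓ₁ * t) ^ 2 * (v ⬝ᵥ v))
    (κ : ℝ) (d ℓ : ℕ) (hℓ : 1 ≤ ℓ) (amin aplus m2plus : ℝ) (ha : 0 < amin) {p₁ : ℝ} (hp₁ : (d : ℝ) + 1 < p₁) :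
    ∃ c : ℝ, 0 < c ∧ ∃ C : ℝ, 0 < C ∧ ∀ (k : ℕ), 1 ≤ k → ∀ (a m2 : ℝ), amin ≤ a → a ≤ aplus → 0 ≤ m2 →
      m2 ≤ m2plus → ∀ (M : Fin (d + 1) → ℕ), (∀ i, 1 ≤ M i) →
      ∀ (emb : ↥(boxDom M) → ↥(Box d ℓ k M)) (Γ : ↥(boxDom M) → ↥(Box d ℓ k M) → List ↥(Box d ℓ k M)),
        (∀ y x, blkWt ((ℓ + 1) ^ k) M (fun i => (ℓ + 1) ^ k * M i) y x ≠ 0 → pathEnd (emb y) (Γ y x) = x) →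
      ∀ (A₀ : Fin (d + 1) → ℝ) (A' : ↥(Box d ℓ k M) → ↥(Box d ℓ k M) → ℝ) (θ θ' τ : ℝ),
        IsUnit (opA d F κ ℓ k a m2 M emb Γ (constBond A₀ Subtype.val + A')).det →
        0 ≤ θ → (∀ x y : ↥(Box d ℓ k M), y.1 ∈ nbrs x.1 → |κ * A' x y| ≤ θ / ((ℓ + 1) ^ k : ℕ)) →
        0 ≤ θ' → (∀ (x z y : ↥(Box d ℓ k M)) (μ : Fin (d + 1)), z.1 = x.1 + e1 μ → y.1 = z.1 + e1 μ →
          |κ * (A' y z - A' z x)| ≤ θ' / (((ℓ + 1) ^ k : ℕ) : ℝ) ^ 2 ∧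
          |κ * (A' x z - A' z y)| ≤ θ' / (((ℓ + 1) ^ k : ℕ) : ℝ) ^ 2) →
        (∀ (x y : ↥(Box d ℓ k M)) (μ : Fin (d + 1)), y.1 = x.1 + e1 μ →
          (x.1 - e1 μ ∉ Box d ℓ k M ∨ y.1 + e1 μ ∉ Box d ℓ k M) → A' x y = 0 ∧ A' y x = 0) →
        0 ≤ τ → (∀ y x, blkWt ((ℓ + 1) ^ k) M (fun i => (ℓ + 1) ^ k * M i) y x ≠ 0 →
          |κ * lsum A' (emb y) (Γ y x)| ≤ τ) →
        ((d : ℝ) + 2) * c * (((d : ℝ) + 1) * ℓ₁ * (θ + θ') + ((d : ℝ) + 1) * ℓ₁ * θ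
          + ((d : ℝ) + 1) * ℓ₁ ^ 2 * θ ^ 2 + B1.aSeq a ((ℓ : ℝ) + 1) k * (ℓ₁ * τ * (2 + ℓ₁ * τ))) ≤ 1 / 2 →
        ∀ (p : ℝ), p₁ ≤ p →
        ∀ f : ↥(Box d ℓ k M) × ι → ℝ,
          supN (greenA d F κ ℓ k a m2 M emb Γ (constBond A₀ Subtype.val + A') *ᵥ f)
              ≤ 2 * (C * (vol d ℓ k ^ p⁻¹)⁻¹) * lpM p f ∧
          (∀ μ : Fin (d + 1),
            supN (derivA0 d F κ ℓ k M A₀ μ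
                *ᵥ (greenA d F κ ℓ k a m2 M emb Γ (constBond A₀ Subtype.val + A') *ᵥ f))
              ≤ 2 * (C * (vol d ℓ k ^ p⁻¹)⁻¹) * lpM p f) ∧
          ∀ μ : Fin (d + 1),
            supN (derivA d F κ ℓ k M (constBond A₀ Subtype.val + A') μ
                *ᵥ (greenA d F κ ℓ k a m2 M emb Γ (constBond A₀ Subtype.val + A') *ᵥ f))
              ≤ (1 + ℓ₁ * θ) * (2 * (C * (vol d ℓ k ^ p⁻¹)⁻¹)) * lpM p f := by
  obtain ⟨c, hc, h⟩ := lemma22_17_psup_box F hℓ₁ hLip κ d ℓ hℓ amin aplus m2plus ha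
  obtain ⟨C, hC, hz⟩ := zero_box_psup_eta ι d ℓ hℓ amin aplus m2plus ha hp₁
  refine ⟨c, hc, C, hC, ?_⟩
  intro k hk a m2 e1' e2 e3 e4 M hM emb Γ hend A₀ A' θ θ' τ hunit hθ hA' hθ' hder hbd hτ0 hτ hsm p hp f
  obtain ⟨hz0, hzD⟩ := hz k hk a m2 e1' e2 e3 e4 M hM p hp
  have hd0 : (0 : ℝ) ≤ d := Nat.cast_nonneg d
  have hp1 : 1 ≤ p := by linarith
  have hC' : 0 ≤ C * (vol d ℓ k ^ p⁻¹)⁻¹ :=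
    mul_nonneg hC.le (inv_nonneg.2 (Real.rpow_nonneg (vol_pos d ℓ k).le _))
  exact h k hk a m2 e1' e2 e3 e4 M hM emb Γ hend A₀ A' θ θ' τ hunit hθ hA' hθ' hder hbd hτ0 hτ hsm p hp1 _ hC'
    hz0 hzD f

/-- **(2.17) FOR `G_k(□,Ã)` ON A BOX WITH THE `η`-DECAY, THIRD MEMBER `G(D^η_{A₀,μ})ᵀ`, `G(D^η_{Ã,μ})ᵀ`
(`(D^η_μ)ᵀ = D^{η*}_μ`), ALL PAIRS `1 < p ≤ q < ∞` WITH `1/p − 1/q ≤ 1/p₁`**: `‖G(D^η_{A₀,μ})ᵀf‖_q ≤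
2C·vol^{−(1/p−1/q)}‖f‖_p`, `‖G(D^η_{Ã,μ})ᵀf‖_q ≤ (1+ℓθ)2C·vol^{−(1/p−1/q)}‖f‖_p` — «Again by the duality argument»:
`B4Lemma22LpLqTransfer.lemma22_17_pq_box_dual` fed with `zero_box_pq_eta` at the dual pair `(q',p')`, which lies in
the same parallelogram (`1/q' − 1/p' = 1/p − 1/q`, `conj_sub_eq`; `q' ≤ p'`, `B4Lemma22InterpBox.conj_antitone`).
[cite: Balaban1983RegularityDecay, Lemma 2.2 (2.17) p. 578; p. 581; p. 583] -/
theorem lemma22_17_pq_box_dual_eta (F : OrthFlow ι) {ℓ₁ : ℝ} (hℓ₁ : 0 ≤ ℓ₁)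
    (hLip : ∀ t (v : ι → ℝ), ((F.U t - 1) *ᵥ v) ⬝ᵥ ((F.U t - 1) *ᵥ v) ≤ (ℓ₁ * t) ^ 2 * (v ⬝ᵥ v))
    (κ : ℝ) (d ℓ : ℕ) (hℓ : 1 ≤ ℓ) (amin aplus m2plus : ℝ) (ha : 0 < amin) {p₁ : ℝ} (hp₁ : (d : ℝ) + 1 < p₁) :
    ∃ c : ℝ, 0 < c ∧ ∃ C : ℝ, 0 < C ∧ ∀ (k : ℕ), 1 ≤ k → ∀ (a m2 : ℝ), amin ≤ a → a ≤ aplus → 0 ≤ m2 →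
      m2 ≤ m2plus → ∀ (M : Fin (d + 1) → ℕ), (∀ i, 1 ≤ M i) →
      ∀ (emb : ↥(boxDom M) → ↥(Box d ℓ k M)) (Γ : ↥(boxDom M) → ↥(Box d ℓ k M) → List ↥(Box d ℓ k M)),
        (∀ y x, blkWt ((ℓ + 1) ^ k) M (fun i => (ℓ + 1) ^ k * M i) y x ≠ 0 → pathEnd (emb y) (Γ y x) = x) →
      ∀ (A₀ : Fin (d + 1) → ℝ) (A' : ↥(Box d ℓ k M) → ↥(Box d ℓ k M) → ℝ) (θ θ' τ : ℝ),
        IsUnit (opA d F κ ℓ k a m2 M emb Γ (constBond A₀ Subtype.val + A')).det →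
        0 ≤ θ → (∀ x y : ↥(Box d ℓ k M), y.1 ∈ nbrs x.1 → |κ * A' x y| ≤ θ / ((ℓ + 1) ^ k : ℕ)) →
        0 ≤ θ' → (∀ (x z y : ↥(Box d ℓ k M)) (μ : Fin (d + 1)), z.1 = x.1 + e1 μ → y.1 = z.1 + e1 μ →
          |κ * (A' y z - A' z x)| ≤ θ' / (((ℓ + 1) ^ k : ℕ) : ℝ) ^ 2 ∧
          |κ * (A' x z - A' z y)| ≤ θ' / (((ℓ + 1) ^ k : ℕ) : ℝ) ^ 2) →
        (∀ (x y : ↥(Box d ℓ k M)) (μ : Fin (d + 1)), y.1 = x.1 + e1 μ →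
          (x.1 - e1 μ ∉ Box d ℓ k M ∨ y.1 + e1 μ ∉ Box d ℓ k M) → A' x y = 0 ∧ A' y x = 0) →
        0 ≤ τ → (∀ y x, blkWt ((ℓ + 1) ^ k) M (fun i => (ℓ + 1) ^ k * M i) y x ≠ 0 →
          |κ * lsum A' (emb y) (Γ y x)| ≤ τ) →
        ((d : ℝ) + 2) * c * (((d : ℝ) + 1) * ℓ₁ * (θ + θ') + ((d : ℝ) + 1) * ℓ₁ * θ
          + ((d : ℝ) + 1) * ℓ₁ ^ 2 * θ ^ 2 + B1.aSeq a ((ℓ : ℝ) + 1) k * (ℓ₁ * τ * (2 + ℓ₁ * τ))) ≤ 1 / 2 →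
        ∀ (p p' q q' : ℝ), p.HolderConjugate p' → q.HolderConjugate q' → p ≤ q → p⁻¹ - q⁻¹ ≤ p₁⁻¹ →
        ∀ f : ↥(Box d ℓ k M) × ι → ℝ,
          (∀ μ : Fin (d + 1),
            lpM q ((greenA d F κ ℓ k a m2 M emb Γ (constBond A₀ Subtype.val + A')
                * (derivA0 d F κ ℓ k M A₀ μ)ᵀ) *ᵥ f) ≤ 2 * (C * (vol d ℓ k ^ (p⁻¹ - q⁻¹))⁻¹) * lpM p f) ∧
          ∀ μ : Fin (d + 1),
            lpM q ((greenA d F κ ℓ k a m2 M emb Γ (constBond A₀ Subtype.val + A')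
                * (derivA d F κ ℓ k M (constBond A₀ Subtype.val + A') μ)ᵀ) *ᵥ f)
              ≤ (1 + ℓ₁ * θ) * (2 * (C * (vol d ℓ k ^ (p⁻¹ - q⁻¹))⁻¹)) * lpM p f := by
  obtain ⟨c, hc, h⟩ := lemma22_17_pq_box_dual F hℓ₁ hLip κ d ℓ hℓ amin aplus m2plus ha
  obtain ⟨C, hC, hz⟩ := zero_box_pq_eta ι d ℓ hℓ amin aplus m2plus ha hp₁
  refine ⟨c, hc, C, hC, ?_⟩
  intro k hk a m2 e1' e2 e3 e4 M hM emb Γ hend A₀ A' θ θ' τ hunit hθ hA' hθ' hder hbd hτ0 hτ hsm p p' q q' hpc hqc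
    hpq hσ f
  have hσ' : q'⁻¹ - p'⁻¹ ≤ p₁⁻¹ := by rw [conj_sub_eq hpc hqc]; exact hσ
  obtain ⟨hz0, hzD⟩ := hz k hk a m2 e1' e2 e3 e4 M hM q' p' hqc.symm.lt.le (conj_antitone hpc hqc hpq) hσ'
  rw [conj_sub_eq hpc hqc] at hz0 hzD
  have hC' : 0 ≤ C * (vol d ℓ k ^ (p⁻¹ - q⁻¹))⁻¹ :=
    mul_nonneg hC.le (inv_nonneg.2 (Real.rpow_nonneg (vol_pos d ℓ k).le _))
  exact h k hk a m2 e1' e2 e3 e4 M hM emb Γ hend A₀ A' θ θ' τ hunit hθ hA' hθ' hder hbd hτ0 hτ hsm p p' q q' hpc hqc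
    _ hC' hz0 hzD f

/-- **(2.17) FOR `G_k(□,Ã)` ON A FINE BOX WITH THE STAIRCASE CONTOURS, WITH THE `η`-DECAY, MEMBERS `G`, `D^η_{A₀,μ}G`,
`D^η_{Ã,μ}G`, ALL PAIRS `1 ≤ p ≤ q < ∞` WITH `1/p − 1/q ≤ 1/p₁`, EVERYTHING DISCHARGED** but the printed smallness
hypotheses on the field: `‖Gf‖_q ≤ 2C·vol^{−(1/p−1/q)}‖f‖_p`, `‖D^η_{A₀,μ}Gf‖_q ≤ 2C·vol^{−(1/p−1/q)}‖f‖_p`,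
`‖D^η_{Ã,μ}Gf‖_q ≤ (1+ℓθ)2C·vol^{−(1/p−1/q)}‖f‖_p`.  `B4Lemma22LpLqTransfer.lemma22_17_pq_stair` + `zero_box_pq_eta`.
[cite: Balaban1983RegularityDecay, Lemma 2.2 (2.17) p. 578; proof pp. 579–583] -/
theorem lemma22_17_pq_stair_eta (F : OrthFlow ι) {ℓ₁ : ℝ} (hℓ₁ : 0 ≤ ℓ₁)
    (hLip : ∀ t (v : ι → ℝ), ((F.U t - 1) *ᵥ v) ⬝ᵥ ((F.U t - 1) *ᵥ v) ≤ (ℓ₁ * t) ^ 2 * (v ⬝ᵥ v))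
    (κ : ℝ) (d ℓ : ℕ) (hℓ : 1 ≤ ℓ) (amin aplus m2plus : ℝ) (ha : 0 < amin) {p₁ : ℝ} (hp₁ : (d : ℝ) + 1 < p₁) :
    ∃ c : ℝ, 0 < c ∧ ∃ C : ℝ, 0 < C ∧ ∀ (k : ℕ), 1 ≤ k → ∀ (hn : 1 ≤ (ℓ + 1) ^ k) (a m2 : ℝ),
      amin ≤ a → a ≤ aplus → 0 ≤ m2 → m2 ≤ m2plus →
      ∀ (M : Fin (d + 1) → ℕ), (∀ i, 1 ≤ M i) →
      ∀ (A₀ : Fin (d + 1) → ℝ) (A' : ↥(Box d ℓ k M) → ↥(Box d ℓ k M) → ℝ) (θ θ' : ℝ),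
        0 ≤ θ → (∀ x y : ↥(Box d ℓ k M), y.1 ∈ nbrs x.1 → |κ * A' x y| ≤ θ / ((ℓ + 1) ^ k : ℕ)) →
        0 ≤ θ' → (∀ (x z y : ↥(Box d ℓ k M)) (μ : Fin (d + 1)), z.1 = x.1 + e1 μ → y.1 = z.1 + e1 μ →
          |κ * (A' y z - A' z x)| ≤ θ' / (((ℓ + 1) ^ k : ℕ) : ℝ) ^ 2 ∧
          |κ * (A' x z - A' z y)| ≤ θ' / (((ℓ + 1) ^ k : ℕ) : ℝ) ^ 2) →
        (∀ (x y : ↥(Box d ℓ k M)) (μ : Fin (d + 1)), y.1 = x.1 + e1 μ →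
          (x.1 - e1 μ ∉ Box d ℓ k M ∨ y.1 + e1 μ ∉ Box d ℓ k M) → A' x y = 0 ∧ A' y x = 0) →
        ℓ₁ ^ 2 * θ ^ 2 * ((d : ℝ) + 1) * (1 + B1.aSeq a ((ℓ : ℝ) + 1) k * ((d : ℝ) + 1))
          ≤ min 2 (B1.aSeq a ((ℓ : ℝ) + 1) k) / 4 →
        ((d : ℝ) + 2) * c * (((d : ℝ) + 1) * ℓ₁ * (θ + θ') + ((d : ℝ) + 1) * ℓ₁ * θ
          + ((d : ℝ) + 1) * ℓ₁ ^ 2 * θ ^ 2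
          + B1.aSeq a ((ℓ : ℝ) + 1) k * (ℓ₁ * (((d : ℝ) + 1) * θ) * (2 + ℓ₁ * (((d : ℝ) + 1) * θ)))) ≤ 1 / 2 →
        ∀ (p q : ℝ), 1 ≤ p → p ≤ q → p⁻¹ - q⁻¹ ≤ p₁⁻¹ →
        ∀ f : ↥(Box d ℓ k M) × ι → ℝ,
          lpM q (greenA d F κ ℓ k a m2 M (baseEmb hn M) (stairContour hn M) (constBond A₀ Subtype.val + A') *ᵥ f)
              ≤ 2 * (C * (vol d ℓ k ^ (p⁻¹ - q⁻¹))⁻¹) * lpM p f ∧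
          (∀ μ : Fin (d + 1),
            lpM q (derivA0 d F κ ℓ k M A₀ μ
                *ᵥ (greenA d F κ ℓ k a m2 M (baseEmb hn M) (stairContour hn M) (constBond A₀ Subtype.val + A')
                    *ᵥ f)) ≤ 2 * (C * (vol d ℓ k ^ (p⁻¹ - q⁻¹))⁻¹) * lpM p f) ∧
          ∀ μ : Fin (d + 1),
            lpM q (derivA d F κ ℓ k M (constBond A₀ Subtype.val + A') μ
                *ᵥ (greenA d F κ ℓ k a m2 M (baseEmb hn M) (stairContour hn M) (constBond A₀ Subtype.val + A')
                    *ᵥ f))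
              ≤ (1 + ℓ₁ * θ) * (2 * (C * (vol d ℓ k ^ (p⁻¹ - q⁻¹))⁻¹)) * lpM p f := by
  obtain ⟨c, hc, h⟩ := lemma22_17_pq_stair F hℓ₁ hLip κ d ℓ hℓ amin aplus m2plus ha
  obtain ⟨C, hC, hz⟩ := zero_box_pq_eta ι d ℓ hℓ amin aplus m2plus ha hp₁
  refine ⟨c, hc, C, hC, ?_⟩
  intro k hk hn a m2 e1' e2 e3 e4 M hM A₀ A' θ θ' hθ hA' hθ' hder hbd hsm2 hsm p q hp hpq hσ f
  obtain ⟨hz0, hzD⟩ := hz k hk a m2 e1' e2 e3 e4 M hM p q hp hpq hσ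
  have hC' : 0 ≤ C * (vol d ℓ k ^ (p⁻¹ - q⁻¹))⁻¹ :=
    mul_nonneg hC.le (inv_nonneg.2 (Real.rpow_nonneg (vol_pos d ℓ k).le _))
  exact h k hk hn a m2 e1' e2 e3 e4 M hM A₀ A' θ θ' hθ hA' hθ' hder hbd hsm2 hsm p q hp (hp.trans hpq) _ hC'
    hz0 hzD f

end Box

/-! ## §5 THE PRINTED `η`-WEIGHTED NORMS: (2.17) WITH A CONSTANT INDEPENDENT OF `η` -/

section Weighted

variable {ι : Type} [Fintype ι] [DecidableEq ι]
variable {X : Type*} [Fintype X] {Y : Type*} [Fintype Y]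

/-- the printed `η`-weighted `L^p` norm of a vector field on a region of the `η`-lattice, `η = L^{-k}`:
`‖Φ‖_{p,η} := (Σ_x η^{d+1}|Φ(x)|^p)^{1/p} = vol^{−1/p}·‖Φ‖_p` (`vol = η^{−(d+1)}`, `‖·‖_p = B4Lemma22LpStair.lpM p` the
counting-measure norm) — the normalisation in which (2.41) reads «η2c₀O(1)η^{−d/p₁}‖f‖_{p₁}» (print's `d` = our
`d + 1`). [cite: Balaban1983RegularityDecay, (2.17) p. 578, (2.41) p. 583, dictionary] [folklore] -/
def lpW (d ℓ k : ℕ) (p : ℝ) (Φ : X × ι → ℝ) : ℝ := (vol d ℓ k)⁻¹ ^ p⁻¹ * lpM p Φ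

omit [DecidableEq ι] in
/-- `‖Φ‖_{p,η} ≥ 0`. [folklore] -/
theorem lpW_nonneg (d ℓ k : ℕ) (p : ℝ) (Φ : X × ι → ℝ) : 0 ≤ lpW d ℓ k p Φ :=
  mul_nonneg (Real.rpow_nonneg (inv_nonneg.2 (vol_pos d ℓ k).le) _) (lpM_nonneg _ _)

/-- the weight bookkeeping: `vol^{−1/q}·vol^{−(1/p−1/q)} = vol^{−1/p}`. [folklore] -/
theorem weight_identity {V : ℝ} (hV : 0 < V) (p q : ℝ) : V⁻¹ ^ q⁻¹ * (V ^ (p⁻¹ - q⁻¹))⁻¹ = V⁻¹ ^ p⁻¹ := by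
  rw [Real.inv_rpow hV.le, Real.inv_rpow hV.le, ← mul_inv, ← Real.rpow_add hV,
    show q⁻¹ + (p⁻¹ - q⁻¹) = p⁻¹ by ring]

omit [DecidableEq ι] in
/-- **COUNTING-MEASURE BOUND WITH THE `η`-DECAY ⇔ `η`-UNIFORM WEIGHTED BOUND**: `‖Ψ‖_q ≤ c·vol^{−(1/p−1/q)}‖Φ‖_p` gives
`‖Ψ‖_{q,η} ≤ c‖Φ‖_{p,η}`. [folklore] -/
theorem lpW_le_of_lpM {d ℓ k : ℕ} {p q c : ℝ} {Φ : X × ι → ℝ} {Ψ : Y × ι → ℝ}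
    (h : lpM q Ψ ≤ c * (vol d ℓ k ^ (p⁻¹ - q⁻¹))⁻¹ * lpM p Φ) : lpW d ℓ k q Ψ ≤ c * lpW d ℓ k p Φ := by
  have hV := vol_pos d ℓ k
  have hw : 0 ≤ (vol d ℓ k)⁻¹ ^ q⁻¹ := Real.rpow_nonneg (inv_nonneg.2 hV.le) _
  unfold lpW
  calc (vol d ℓ k)⁻¹ ^ q⁻¹ * lpM q Ψ ≤ (vol d ℓ k)⁻¹ ^ q⁻¹ * (c * (vol d ℓ k ^ (p⁻¹ - q⁻¹))⁻¹ * lpM p Φ) :=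
        mul_le_mul_of_nonneg_left h hw
    _ = c * (((vol d ℓ k)⁻¹ ^ q⁻¹ * (vol d ℓ k ^ (p⁻¹ - q⁻¹))⁻¹) * lpM p Φ) := by ring
    _ = c * ((vol d ℓ k)⁻¹ ^ p⁻¹ * lpM p Φ) := by rw [weight_identity hV]

omit [DecidableEq ι] [Fintype Y] in
/-- the sup-target version: `‖Ψ‖_∞ ≤ c·vol^{−1/p}‖Φ‖_p` is `‖Ψ‖_∞ ≤ c‖Φ‖_{p,η}`. [folklore] -/
theorem supN_le_lpW_of {d ℓ k : ℕ} {p c : ℝ} {Φ : X × ι → ℝ} {Ψ : Y × ι → ℝ}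
    (h : supN Ψ ≤ c * (vol d ℓ k ^ p⁻¹)⁻¹ * lpM p Φ) : supN Ψ ≤ c * lpW d ℓ k p Φ := by
  unfold lpW
  rw [Real.inv_rpow (vol_pos d ℓ k).le, ← mul_assoc]
  exact h

/-- **B4 LEMMA 2.2 (2.17) FOR `G_k(□,Ã)` ON A BOX IN THE PRINTED `η`-WEIGHTED NORMS, MEMBERS `G`, `D^η_{A₀,μ}G`,
`D^η_{Ã,μ}G`, ALL PAIRS `1 ≤ p ≤ q < ∞` OF THE PARALLELOGRAM «1/p − 1/p₁ ≤ 1/q ≤ 1/p», `p₁ > d + 1`, THE CONSTANT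
INDEPENDENT OF `η`**: `‖Gf‖_{q,η} ≤ 2C‖f‖_{p,η}`, `‖D^η_{A₀,μ}Gf‖_{q,η} ≤ 2C‖f‖_{p,η}`, `‖D^η_{Ã,μ}Gf‖_{q,η} ≤
(1+ℓθ)2C‖f‖_{p,η}` uniformly over `k ≥ 1` (`η = L^{-k}`), the window, the box, the contour system and the field under
the printed smallness hypotheses (`lemma22_17_pq_box_eta` + `lpW_le_of_lpM`).
[cite: Balaban1983RegularityDecay, Lemma 2.2 (2.17) p. 578; proof pp. 579–583] -/
theorem lemma22_17_weighted_box (F : OrthFlow ι) {ℓ₁ : ℝ} (hℓ₁ : 0 ≤ ℓ₁)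
    (hLip : ∀ t (v : ι → ℝ), ((F.U t - 1) *ᵥ v) ⬝ᵥ ((F.U t - 1) *ᵥ v) ≤ (ℓ₁ * t) ^ 2 * (v ⬝ᵥ v))
    (κ : ℝ) (d ℓ : ℕ) (hℓ : 1 ≤ ℓ) (amin aplus m2plus : ℝ) (ha : 0 < amin) {p₁ : ℝ} (hp₁ : (d : ℝ) + 1 < p₁) :
    ∃ c : ℝ, 0 < c ∧ ∃ C : ℝ, 0 < C ∧ ∀ (k : ℕ), 1 ≤ k → ∀ (a m2 : ℝ), amin ≤ a → a ≤ aplus → 0 ≤ m2 →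
      m2 ≤ m2plus → ∀ (M : Fin (d + 1) → ℕ), (∀ i, 1 ≤ M i) →
      ∀ (emb : ↥(boxDom M) → ↥(Box d ℓ k M)) (Γ : ↥(boxDom M) → ↥(Box d ℓ k M) → List ↥(Box d ℓ k M)),
        (∀ y x, blkWt ((ℓ + 1) ^ k) M (fun i => (ℓ + 1) ^ k * M i) y x ≠ 0 → pathEnd (emb y) (Γ y x) = x) →
      ∀ (A₀ : Fin (d + 1) → ℝ) (A' : ↥(Box d ℓ k M) → ↥(Box d ℓ k M) → ℝ) (θ θ' τ : ℝ),
        IsUnit (opA d F κ ℓ k a m2 M emb Γ (constBond A₀ Subtype.val + A')).det →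
        0 ≤ θ → (∀ x y : ↥(Box d ℓ k M), y.1 ∈ nbrs x.1 → |κ * A' x y| ≤ θ / ((ℓ + 1) ^ k : ℕ)) →
        0 ≤ θ' → (∀ (x z y : ↥(Box d ℓ k M)) (μ : Fin (d + 1)), z.1 = x.1 + e1 μ → y.1 = z.1 + e1 μ →
          |κ * (A' y z - A' z x)| ≤ θ' / (((ℓ + 1) ^ k : ℕ) : ℝ) ^ 2 ∧
          |κ * (A' x z - A' z y)| ≤ θ' / (((ℓ + 1) ^ k : ℕ) : ℝ) ^ 2) →
        (∀ (x y : ↥(Box d ℓ k M)) (μ : Fin (d + 1)), y.1 = x.1 + e1 μ →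
          (x.1 - e1 μ ∉ Box d ℓ k M ∨ y.1 + e1 μ ∉ Box d ℓ k M) → A' x y = 0 ∧ A' y x = 0) →
        0 ≤ τ → (∀ y x, blkWt ((ℓ + 1) ^ k) M (fun i => (ℓ + 1) ^ k * M i) y x ≠ 0 →
          |κ * lsum A' (emb y) (Γ y x)| ≤ τ) →
        ((d : ℝ) + 2) * c * (((d : ℝ) + 1) * ℓ₁ * (θ + θ') + ((d : ℝ) + 1) * ℓ₁ * θ
          + ((d : ℝ) + 1) * ℓ₁ ^ 2 * θ ^ 2 + B1.aSeq a ((ℓ : ℝ) + 1) k * (ℓ₁ * τ * (2 + ℓ₁ * τ))) ≤ 1 / 2 →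
        ∀ (p q : ℝ), 1 ≤ p → p ≤ q → p⁻¹ - q⁻¹ ≤ p₁⁻¹ →
        ∀ f : ↥(Box d ℓ k M) × ι → ℝ,
          lpW d ℓ k q (greenA d F κ ℓ k a m2 M emb Γ (constBond A₀ Subtype.val + A') *ᵥ f)
              ≤ 2 * C * lpW d ℓ k p f ∧
          (∀ μ : Fin (d + 1),
            lpW d ℓ k q (derivA0 d F κ ℓ k M A₀ μ
                *ᵥ (greenA d F κ ℓ k a m2 M emb Γ (constBond A₀ Subtype.val + A') *ᵥ f))
              ≤ 2 * C * lpW d ℓ k p f) ∧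
          ∀ μ : Fin (d + 1),
            lpW d ℓ k q (derivA d F κ ℓ k M (constBond A₀ Subtype.val + A') μ
                *ᵥ (greenA d F κ ℓ k a m2 M emb Γ (constBond A₀ Subtype.val + A') *ᵥ f))
              ≤ (1 + ℓ₁ * θ) * (2 * C) * lpW d ℓ k p f := by
  obtain ⟨c, hc, C, hC, h⟩ := lemma22_17_pq_box_eta F hℓ₁ hLip κ d ℓ hℓ amin aplus m2plus ha hp₁
  refine ⟨c, hc, C, hC, ?_⟩
  intro k hk a m2 e1' e2 e3 e4 M hM emb Γ hend A₀ A' θ θ' τ hunit hθ hA' hθ' hder hbd hτ0 hτ hsm p q hp hpq hσ f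
  obtain ⟨h0, h1, h2⟩ := h k hk a m2 e1' e2 e3 e4 M hM emb Γ hend A₀ A' θ θ' τ hunit hθ hA' hθ' hder hbd hτ0 hτ
    hsm p q hp hpq hσ f
  refine ⟨lpW_le_of_lpM (by linarith [h0]), fun μ => lpW_le_of_lpM (by linarith [h1 μ]),
    fun μ => lpW_le_of_lpM (by linarith [h2 μ])⟩

/-- **B4 LEMMA 2.2 (2.17) FOR `G_k(□,Ã)` ON A BOX, THE EDGE `q = ∞`, `p ≥ p₁ > d + 1` OF THE PARALLELOGRAM, IN THE
PRINTED SCALING**: `‖Gf‖_∞ ≤ 2C‖f‖_{p,η}`, `‖D^η_{A₀,μ}Gf‖_∞ ≤ 2C‖f‖_{p,η}`, `‖D^η_{Ã,μ}Gf‖_∞ ≤ (1+ℓθ)2C‖f‖_{p,η}`, the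
constant independent of `η` («the operators G_k(□), ∂^η_μG_k(□), G_k(□)∂^{η*}_μ are bounded operators from L^{p₁}(□)
with p₁ > d to L^∞(□)», here for `G_k(□,Ã)`).  `lemma22_17_psup_box_eta` + `supN_le_lpW_of`.
[cite: Balaban1983RegularityDecay, Lemma 2.2 (2.17) p. 578; (2.40)–(2.41) p. 583] -/
theorem lemma22_17_weighted_box_sup (F : OrthFlow ι) {ℓ₁ : ℝ} (hℓ₁ : 0 ≤ ℓ₁)
    (hLip : ∀ t (v : ι → ℝ), ((F.U t - 1) *ᵥ v) ⬝ᵥ ((F.U t - 1) *ᵥ v) ≤ (ℓ₁ * t) ^ 2 * (v ⬝ᵥ v))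
    (κ : ℝ) (d ℓ : ℕ) (hℓ : 1 ≤ ℓ) (amin aplus m2plus : ℝ) (ha : 0 < amin) {p₁ : ℝ} (hp₁ : (d : ℝ) + 1 < p₁) :
    ∃ c : ℝ, 0 < c ∧ ∃ C : ℝ, 0 < C ∧ ∀ (k : ℕ), 1 ≤ k → ∀ (a m2 : ℝ), amin ≤ a → a ≤ aplus → 0 ≤ m2 →
      m2 ≤ m2plus → ∀ (M : Fin (d + 1) → ℕ), (∀ i, 1 ≤ M i) →
      ∀ (emb : ↥(boxDom M) → ↥(Box d ℓ k M)) (Γ : ↥(boxDom M) → ↥(Box d ℓ k M) → List ↥(Box d ℓ k M)),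
        (∀ y x, blkWt ((ℓ + 1) ^ k) M (fun i => (ℓ + 1) ^ k * M i) y x ≠ 0 → pathEnd (emb y) (Γ y x) = x) →
      ∀ (A₀ : Fin (d + 1) → ℝ) (A' : ↥(Box d ℓ k M) → ↥(Box d ℓ k M) → ℝ) (θ θ' τ : ℝ),
        IsUnit (opA d F κ ℓ k a m2 M emb Γ (constBond A₀ Subtype.val + A')).det →
        0 ≤ θ → (∀ x y : ↥(Box d ℓ k M), y.1 ∈ nbrs x.1 → |κ * A' x y| ≤ θ / ((ℓ + 1) ^ k : ℕ)) →
        0 ≤ θ' → (∀ (x z y : ↥(Box d ℓ k M)) (μ : Fin (d + 1)), z.1 = x.1 + e1 μ → y.1 = z.1 + e1 μ →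
          |κ * (A' y z - A' z x)| ≤ θ' / (((ℓ + 1) ^ k : ℕ) : ℝ) ^ 2 ∧
          |κ * (A' x z - A' z y)| ≤ θ' / (((ℓ + 1) ^ k : ℕ) : ℝ) ^ 2) →
        (∀ (x y : ↥(Box d ℓ k M)) (μ : Fin (d + 1)), y.1 = x.1 + e1 μ →
          (x.1 - e1 μ ∉ Box d ℓ k M ∨ y.1 + e1 μ ∉ Box d ℓ k M) → A' x y = 0 ∧ A' y x = 0) →
        0 ≤ τ → (∀ y x, blkWt ((ℓ + 1) ^ k) M (fun i => (ℓ + 1) ^ k * M i) y x ≠ 0 →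
          |κ * lsum A' (emb y) (Γ y x)| ≤ τ) →
        ((d : ℝ) + 2) * c * (((d : ℝ) + 1) * ℓ₁ * (θ + θ') + ((d : ℝ) + 1) * ℓ₁ * θ
          + ((d : ℝ) + 1) * ℓ₁ ^ 2 * θ ^ 2 + B1.aSeq a ((ℓ : ℝ) + 1) k * (ℓ₁ * τ * (2 + ℓ₁ * τ))) ≤ 1 / 2 →
        ∀ (p : ℝ), p₁ ≤ p →
        ∀ f : ↥(Box d ℓ k M) × ι → ℝ,
          supN (greenA d F κ ℓ k a m2 M emb Γ (constBond A₀ Subtype.val + A') *ᵥ f) ≤ 2 * C * lpW d ℓ k p f ∧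
          (∀ μ : Fin (d + 1),
            supN (derivA0 d F κ ℓ k M A₀ μ
                *ᵥ (greenA d F κ ℓ k a m2 M emb Γ (constBond A₀ Subtype.val + A') *ᵥ f))
              ≤ 2 * C * lpW d ℓ k p f) ∧
          ∀ μ : Fin (d + 1),
            supN (derivA d F κ ℓ k M (constBond A₀ Subtype.val + A') μ
                *ᵥ (greenA d F κ ℓ k a m2 M emb Γ (constBond A₀ Subtype.val + A') *ᵥ f))
              ≤ (1 + ℓ₁ * θ) * (2 * C) * lpW d ℓ k p f := by
  obtain ⟨c, hc, C, hC, h⟩ := lemma22_17_psup_box_eta F hℓ₁ hLip κ d ℓ hℓ amin aplus m2plus ha hp₁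
  refine ⟨c, hc, C, hC, ?_⟩
  intro k hk a m2 e1' e2 e3 e4 M hM emb Γ hend A₀ A' θ θ' τ hunit hθ hA' hθ' hder hbd hτ0 hτ hsm p hp f
  obtain ⟨h0, h1, h2⟩ := h k hk a m2 e1' e2 e3 e4 M hM emb Γ hend A₀ A' θ θ' τ hunit hθ hA' hθ' hder hbd hτ0 hτ
    hsm p hp f
  refine ⟨supN_le_lpW_of (by linarith [h0]), fun μ => supN_le_lpW_of (by linarith [h1 μ]),
    fun μ => supN_le_lpW_of (by linarith [h2 μ])⟩

/-- **B4 LEMMA 2.2 (2.17) FOR `G_k(□,Ã)` ON A BOX IN THE PRINTED `η`-WEIGHTED NORMS, THIRD MEMBER `G(D^η_{A₀,μ})ᵀ`,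
`G(D^η_{Ã,μ})ᵀ`, ALL PAIRS `1 < p ≤ q < ∞` WITH `1/p − 1/q ≤ 1/p₁`, THE CONSTANT INDEPENDENT OF `η`**:
`‖G(D^η_{A₀,μ})ᵀf‖_{q,η} ≤ 2C‖f‖_{p,η}`, `‖G(D^η_{Ã,μ})ᵀf‖_{q,η} ≤ (1+ℓθ)2C‖f‖_{p,η}` (`lemma22_17_pq_box_dual_eta` +
`lpW_le_of_lpM`). [cite: Balaban1983RegularityDecay, Lemma 2.2 (2.17) p. 578; p. 583] -/
theorem lemma22_17_weighted_box_dual (F : OrthFlow ι) {ℓ₁ : ℝ} (hℓ₁ : 0 ≤ ℓ₁)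
    (hLip : ∀ t (v : ι → ℝ), ((F.U t - 1) *ᵥ v) ⬝ᵥ ((F.U t - 1) *ᵥ v) ≤ (ℓ₁ * t) ^ 2 * (v ⬝ᵥ v))
    (κ : ℝ) (d ℓ : ℕ) (hℓ : 1 ≤ ℓ) (amin aplus m2plus : ℝ) (ha : 0 < amin) {p₁ : ℝ} (hp₁ : (d : ℝ) + 1 < p₁) :
    ∃ c : ℝ, 0 < c ∧ ∃ C : ℝ, 0 < C ∧ ∀ (k : ℕ), 1 ≤ k → ∀ (a m2 : ℝ), amin ≤ a → a ≤ aplus → 0 ≤ m2 →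
      m2 ≤ m2plus → ∀ (M : Fin (d + 1) → ℕ), (∀ i, 1 ≤ M i) →
      ∀ (emb : ↥(boxDom M) → ↥(Box d ℓ k M)) (Γ : ↥(boxDom M) → ↥(Box d ℓ k M) → List ↥(Box d ℓ k M)),
        (∀ y x, blkWt ((ℓ + 1) ^ k) M (fun i => (ℓ + 1) ^ k * M i) y x ≠ 0 → pathEnd (emb y) (Γ y x) = x) →
      ∀ (A₀ : Fin (d + 1) → ℝ) (A' : ↥(Box d ℓ k M) → ↥(Box d ℓ k M) → ℝ) (θ θ' τ : ℝ),
        IsUnit (opA d F κ ℓ k a m2 M emb Γ (constBond A₀ Subtype.val + A')).det →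
        0 ≤ θ → (∀ x y : ↥(Box d ℓ k M), y.1 ∈ nbrs x.1 → |κ * A' x y| ≤ θ / ((ℓ + 1) ^ k : ℕ)) →
        0 ≤ θ' → (∀ (x z y : ↥(Box d ℓ k M)) (μ : Fin (d + 1)), z.1 = x.1 + e1 μ → y.1 = z.1 + e1 μ →
          |κ * (A' y z - A' z x)| ≤ θ' / (((ℓ + 1) ^ k : ℕ) : ℝ) ^ 2 ∧
          |κ * (A' x z - A' z y)| ≤ θ' / (((ℓ + 1) ^ k : ℕ) : ℝ) ^ 2) →
        (∀ (x y : ↥(Box d ℓ k M)) (μ : Fin (d + 1)), y.1 = x.1 + e1 μ →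
          (x.1 - e1 μ ∉ Box d ℓ k M ∨ y.1 + e1 μ ∉ Box d ℓ k M) → A' x y = 0 ∧ A' y x = 0) →
        0 ≤ τ → (∀ y x, blkWt ((ℓ + 1) ^ k) M (fun i => (ℓ + 1) ^ k * M i) y x ≠ 0 →
          |κ * lsum A' (emb y) (Γ y x)| ≤ τ) →
        ((d : ℝ) + 2) * c * (((d : ℝ) + 1) * ℓ₁ * (θ + θ') + ((d : ℝ) + 1) * ℓ₁ * θ
          + ((d : ℝ) + 1) * ℓ₁ ^ 2 * θ ^ 2 + B1.aSeq a ((ℓ : ℝ) + 1) k * (ℓ₁ * τ * (2 + ℓ₁ * τ))) ≤ 1 / 2 →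
        ∀ (p p' q q' : ℝ), p.HolderConjugate p' → q.HolderConjugate q' → p ≤ q → p⁻¹ - q⁻¹ ≤ p₁⁻¹ →
        ∀ f : ↥(Box d ℓ k M) × ι → ℝ,
          (∀ μ : Fin (d + 1),
            lpW d ℓ k q ((greenA d F κ ℓ k a m2 M emb Γ (constBond A₀ Subtype.val + A')
                * (derivA0 d F κ ℓ k M A₀ μ)ᵀ) *ᵥ f) ≤ 2 * C * lpW d ℓ k p f) ∧
          ∀ μ : Fin (d + 1),
            lpW d ℓ k q ((greenA d F κ ℓ k a m2 M emb Γ (constBond A₀ Subtype.val + A')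
                * (derivA d F κ ℓ k M (constBond A₀ Subtype.val + A') μ)ᵀ) *ᵥ f)
              ≤ (1 + ℓ₁ * θ) * (2 * C) * lpW d ℓ k p f := by
  obtain ⟨c, hc, C, hC, h⟩ := lemma22_17_pq_box_dual_eta F hℓ₁ hLip κ d ℓ hℓ amin aplus m2plus ha hp₁
  refine ⟨c, hc, C, hC, ?_⟩
  intro k hk a m2 e1' e2 e3 e4 M hM emb Γ hend A₀ A' θ θ' τ hunit hθ hA' hθ' hder hbd hτ0 hτ hsm p p' q q' hpc hqc
    hpq hσ f
  obtain ⟨h1, h2⟩ := h k hk a m2 e1' e2 e3 e4 M hM emb Γ hend A₀ A' θ θ' τ hunit hθ hA' hθ' hder hbd hτ0 hτ hsm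
    p p' q q' hpc hqc hpq hσ f
  exact ⟨fun μ => lpW_le_of_lpM (by linarith [h1 μ]), fun μ => lpW_le_of_lpM (by linarith [h2 μ])⟩

/-- **B4 LEMMA 2.2 (2.17) FOR `G_k(□,Ã)` ON A FINE BOX WITH THE STAIRCASE CONTOURS IN THE PRINTED `η`-WEIGHTED NORMS,
MEMBERS `G`, `D^η_{A₀,μ}G`, `D^η_{Ã,μ}G`, ALL PAIRS `1 ≤ p ≤ q < ∞` WITH `1/p − 1/q ≤ 1/p₁`, THE CONSTANT INDEPENDENT
OF `η`** — everything discharged but the printed smallness hypotheses on the field (`lemma22_17_pq_stair_eta` +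
`lpW_le_of_lpM`). [cite: Balaban1983RegularityDecay, Lemma 2.2 (2.17) p. 578; proof pp. 579–583] -/
theorem lemma22_17_weighted_stair (F : OrthFlow ι) {ℓ₁ : ℝ} (hℓ₁ : 0 ≤ ℓ₁)
    (hLip : ∀ t (v : ι → ℝ), ((F.U t - 1) *ᵥ v) ⬝ᵥ ((F.U t - 1) *ᵥ v) ≤ (ℓ₁ * t) ^ 2 * (v ⬝ᵥ v))
    (κ : ℝ) (d ℓ : ℕ) (hℓ : 1 ≤ ℓ) (amin aplus m2plus : ℝ) (ha : 0 < amin) {p₁ : ℝ} (hp₁ : (d : ℝ) + 1 < p₁) :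
    ∃ c : ℝ, 0 < c ∧ ∃ C : ℝ, 0 < C ∧ ∀ (k : ℕ), 1 ≤ k → ∀ (hn : 1 ≤ (ℓ + 1) ^ k) (a m2 : ℝ),
      amin ≤ a → a ≤ aplus → 0 ≤ m2 → m2 ≤ m2plus →
      ∀ (M : Fin (d + 1) → ℕ), (∀ i, 1 ≤ M i) →
      ∀ (A₀ : Fin (d + 1) → ℝ) (A' : ↥(Box d ℓ k M) → ↥(Box d ℓ k M) → ℝ) (θ θ' : ℝ),
        0 ≤ θ → (∀ x y : ↥(Box d ℓ k M), y.1 ∈ nbrs x.1 → |κ * A' x y| ≤ θ / ((ℓ + 1) ^ k : ℕ)) →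
        0 ≤ θ' → (∀ (x z y : ↥(Box d ℓ k M)) (μ : Fin (d + 1)), z.1 = x.1 + e1 μ → y.1 = z.1 + e1 μ →
          |κ * (A' y z - A' z x)| ≤ θ' / (((ℓ + 1) ^ k : ℕ) : ℝ) ^ 2 ∧
          |κ * (A' x z - A' z y)| ≤ θ' / (((ℓ + 1) ^ k : ℕ) : ℝ) ^ 2) →
        (∀ (x y : ↥(Box d ℓ k M)) (μ : Fin (d + 1)), y.1 = x.1 + e1 μ →
          (x.1 - e1 μ ∉ Box d ℓ k M ∨ y.1 + e1 μ ∉ Box d ℓ k M) → A' x y = 0 ∧ A' y x = 0) →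
        ℓ₁ ^ 2 * θ ^ 2 * ((d : ℝ) + 1) * (1 + B1.aSeq a ((ℓ : ℝ) + 1) k * ((d : ℝ) + 1))
          ≤ min 2 (B1.aSeq a ((ℓ : ℝ) + 1) k) / 4 →
        ((d : ℝ) + 2) * c * (((d : ℝ) + 1) * ℓ₁ * (θ + θ') + ((d : ℝ) + 1) * ℓ₁ * θ
          + ((d : ℝ) + 1) * ℓ₁ ^ 2 * θ ^ 2
          + B1.aSeq a ((ℓ : ℝ) + 1) k * (ℓ₁ * (((d : ℝ) + 1) * θ) * (2 + ℓ₁ * (((d : ℝ) + 1) * θ)))) ≤ 1 / 2 →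
        ∀ (p q : ℝ), 1 ≤ p → p ≤ q → p⁻¹ - q⁻¹ ≤ p₁⁻¹ →
        ∀ f : ↥(Box d ℓ k M) × ι → ℝ,
          lpW d ℓ k q (greenA d F κ ℓ k a m2 M (baseEmb hn M) (stairContour hn M) (constBond A₀ Subtype.val + A')
              *ᵥ f) ≤ 2 * C * lpW d ℓ k p f ∧
          (∀ μ : Fin (d + 1),
            lpW d ℓ k q (derivA0 d F κ ℓ k M A₀ μ
                *ᵥ (greenA d F κ ℓ k a m2 M (baseEmb hn M) (stairContour hn M) (constBond A₀ Subtype.val + A')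
                    *ᵥ f)) ≤ 2 * C * lpW d ℓ k p f) ∧
          ∀ μ : Fin (d + 1),
            lpW d ℓ k q (derivA d F κ ℓ k M (constBond A₀ Subtype.val + A') μ
                *ᵥ (greenA d F κ ℓ k a m2 M (baseEmb hn M) (stairContour hn M) (constBond A₀ Subtype.val + A')
                    *ᵥ f))
              ≤ (1 + ℓ₁ * θ) * (2 * C) * lpW d ℓ k p f := by
  obtain ⟨c, hc, C, hC, h⟩ := lemma22_17_pq_stair_eta F hℓ₁ hLip κ d ℓ hℓ amin aplus m2plus ha hp₁
  refine ⟨c, hc, C, hC, ?_⟩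
  intro k hk hn a m2 e1' e2 e3 e4 M hM A₀ A' θ θ' hθ hA' hθ' hder hbd hsm2 hsm p q hp hpq hσ f
  obtain ⟨h0, h1, h2⟩ := h k hk hn a m2 e1' e2 e3 e4 M hM A₀ A' θ θ' hθ hA' hθ' hder hbd hsm2 hsm p q hp hpq hσ f
  refine ⟨lpW_le_of_lpM (by linarith [h0]), fun μ => lpW_le_of_lpM (by linarith [h1 μ]),
    fun μ => lpW_le_of_lpM (by linarith [h2 μ])⟩

end Weighted

/-! ## §6 THE THIRD MEMBER ON THE TWO REMAINING EDGES OF THE PARALLELOGRAM: `p = 1 < q ≤ p₁'` AND `q = ∞`, `p ≥ p₁` -/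

section DualEdges

variable {ι : Type} [Fintype ι] [DecidableEq ι]

/-- **(2.17) FOR `G_k(□,Ã)` WITH THE `η`-DECAY, THIRD MEMBER `G(D^η_{A₀,μ})ᵀ`, `G(D^η_{Ã,μ})ᵀ`, THE EDGE `p = 1`,
`1 < q ≤ p₁'`** (dual exponent `q' ≥ p₁ > d + 1`; decay exponent `1/q' = 1 − 1/q = 1/p − 1/q` at `p = 1`):
`‖G(D^η_{A₀,μ})ᵀf‖_q ≤ 2C·vol^{−1/q'}‖f‖₁`, `‖G(D^η_{Ã,μ})ᵀf‖_q ≤ (1+ℓθ)2C·vol^{−1/q'}‖f‖₁` —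
`B4Lemma22LpLqTransfer.lemma22_17_pq_box_dual_one` («using the fact that the space L^∞(□) is adjoint to L¹(□)»)
fed with `zero_box_psup_eta` at `q'`. [cite: Balaban1983RegularityDecay, Lemma 2.2 (2.17) p. 578; p. 581; p. 583] -/
theorem lemma22_17_pq_box_dual_one_eta (F : OrthFlow ι) {ℓ₁ : ℝ} (hℓ₁ : 0 ≤ ℓ₁)
    (hLip : ∀ t (v : ι → ℝ), ((F.U t - 1) *ᵥ v) ⬝ᵥ ((F.U t - 1) *ᵥ v) ≤ (ℓ₁ * t) ^ 2 * (v ⬝ᵥ v))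
    (κ : ℝ) (d ℓ : ℕ) (hℓ : 1 ≤ ℓ) (amin aplus m2plus : ℝ) (ha : 0 < amin) {p₁ : ℝ} (hp₁ : (d : ℝ) + 1 < p₁) :
    ∃ c : ℝ, 0 < c ∧ ∃ C : ℝ, 0 < C ∧ ∀ (k : ℕ), 1 ≤ k → ∀ (a m2 : ℝ), amin ≤ a → a ≤ aplus → 0 ≤ m2 →
      m2 ≤ m2plus → ∀ (M : Fin (d + 1) → ℕ), (∀ i, 1 ≤ M i) →
      ∀ (emb : ↥(boxDom M) → ↥(Box d ℓ k M)) (Γ : ↥(boxDom M) → ↥(Box d ℓ k M) → List ↥(Box d ℓ k M)),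
        (∀ y x, blkWt ((ℓ + 1) ^ k) M (fun i => (ℓ + 1) ^ k * M i) y x ≠ 0 → pathEnd (emb y) (Γ y x) = x) →
      ∀ (A₀ : Fin (d + 1) → ℝ) (A' : ↥(Box d ℓ k M) → ↥(Box d ℓ k M) → ℝ) (θ θ' τ : ℝ),
        IsUnit (opA d F κ ℓ k a m2 M emb Γ (constBond A₀ Subtype.val + A')).det →
        0 ≤ θ → (∀ x y : ↥(Box d ℓ k M), y.1 ∈ nbrs x.1 → |κ * A' x y| ≤ θ / ((ℓ + 1) ^ k : ℕ)) →
        0 ≤ θ' → (∀ (x z y : ↥(Box d ℓ k M)) (μ : Fin (d + 1)), z.1 = x.1 + e1 μ → y.1 = z.1 + e1 μ →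
          |κ * (A' y z - A' z x)| ≤ θ' / (((ℓ + 1) ^ k : ℕ) : ℝ) ^ 2 ∧
          |κ * (A' x z - A' z y)| ≤ θ' / (((ℓ + 1) ^ k : ℕ) : ℝ) ^ 2) →
        (∀ (x y : ↥(Box d ℓ k M)) (μ : Fin (d + 1)), y.1 = x.1 + e1 μ →
          (x.1 - e1 μ ∉ Box d ℓ k M ∨ y.1 + e1 μ ∉ Box d ℓ k M) → A' x y = 0 ∧ A' y x = 0) →
        0 ≤ τ → (∀ y x, blkWt ((ℓ + 1) ^ k) M (fun i => (ℓ + 1) ^ k * M i) y x ≠ 0 →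
          |κ * lsum A' (emb y) (Γ y x)| ≤ τ) →
        ((d : ℝ) + 2) * c * (((d : ℝ) + 1) * ℓ₁ * (θ + θ') + ((d : ℝ) + 1) * ℓ₁ * θ
          + ((d : ℝ) + 1) * ℓ₁ ^ 2 * θ ^ 2 + B1.aSeq a ((ℓ : ℝ) + 1) k * (ℓ₁ * τ * (2 + ℓ₁ * τ))) ≤ 1 / 2 →
        ∀ (q q' : ℝ), q.HolderConjugate q' → p₁ ≤ q' →
        ∀ f : ↥(Box d ℓ k M) × ι → ℝ,
          (∀ μ : Fin (d + 1),
            lpM q ((greenA d F κ ℓ k a m2 M emb Γ (constBond A₀ Subtype.val + A')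
                * (derivA0 d F κ ℓ k M A₀ μ)ᵀ) *ᵥ f) ≤ 2 * (C * (vol d ℓ k ^ q'⁻¹)⁻¹) * l1N f) ∧
          ∀ μ : Fin (d + 1),
            lpM q ((greenA d F κ ℓ k a m2 M emb Γ (constBond A₀ Subtype.val + A')
                * (derivA d F κ ℓ k M (constBond A₀ Subtype.val + A') μ)ᵀ) *ᵥ f)
              ≤ (1 + ℓ₁ * θ) * (2 * (C * (vol d ℓ k ^ q'⁻¹)⁻¹)) * l1N f := by
  obtain ⟨c, hc, h⟩ := lemma22_17_pq_box_dual_one F hℓ₁ hLip κ d ℓ hℓ amin aplus m2plus ha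
  obtain ⟨C, hC, hz⟩ := zero_box_psup_eta ι d ℓ hℓ amin aplus m2plus ha hp₁
  refine ⟨c, hc, C, hC, ?_⟩
  intro k hk a m2 e1' e2 e3 e4 M hM emb Γ hend A₀ A' θ θ' τ hunit hθ hA' hθ' hder hbd hτ0 hτ hsm q q' hqc hq' f
  obtain ⟨hz0, hzD⟩ := hz k hk a m2 e1' e2 e3 e4 M hM q' hq'
  have hC' : 0 ≤ C * (vol d ℓ k ^ q'⁻¹)⁻¹ :=
    mul_nonneg hC.le (inv_nonneg.2 (Real.rpow_nonneg (vol_pos d ℓ k).le _))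
  exact h k hk a m2 e1' e2 e3 e4 M hM emb Γ hend A₀ A' θ θ' τ hunit hθ hA' hθ' hder hbd hτ0 hτ hsm q q' hqc _ hC'
    hz0 hzD f

/-- **(2.17) FOR `G_k(□,Ã)` WITH THE `η`-DECAY, THIRD MEMBER `G(D^η_{A₀,μ})ᵀ`, `G(D^η_{Ã,μ})ᵀ`, THE EDGE `q = ∞`,
`p₁ ≤ p < ∞`** (dual exponent `1 < p' ≤ p₁'`; decay exponent `1/p = 1 − 1/p'`): `‖G(D^η_{A₀,μ})ᵀf‖_∞ ≤
2C·vol^{−1/p}‖f‖_p`, `‖G(D^η_{Ã,μ})ᵀf‖_∞ ≤ (1+ℓθ)2C·vol^{−1/p}‖f‖_p` —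
`B4Lemma22LpLqTransfer.lemma22_17_pq_box_dual_sup` («bounded operators from L¹(□) to L^{p'₁}(□), p'₁^{−1} + p₁^{−1}
= 1») fed with `zero_box_pq_eta` at the pair `(1, p')`.
[cite: Balaban1983RegularityDecay, Lemma 2.2 (2.17) p. 578; p. 581; p. 583] -/
theorem lemma22_17_pq_box_dual_sup_eta (F : OrthFlow ι) {ℓ₁ : ℝ} (hℓ₁ : 0 ≤ ℓ₁)
    (hLip : ∀ t (v : ι → ℝ), ((F.U t - 1) *ᵥ v) ⬝ᵥ ((F.U t - 1) *ᵥ v) ≤ (ℓ₁ * t) ^ 2 * (v ⬝ᵥ v))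
    (κ : ℝ) (d ℓ : ℕ) (hℓ : 1 ≤ ℓ) (amin aplus m2plus : ℝ) (ha : 0 < amin) {p₁ : ℝ} (hp₁ : (d : ℝ) + 1 < p₁) :
    ∃ c : ℝ, 0 < c ∧ ∃ C : ℝ, 0 < C ∧ ∀ (k : ℕ), 1 ≤ k → ∀ (a m2 : ℝ), amin ≤ a → a ≤ aplus → 0 ≤ m2 →
      m2 ≤ m2plus → ∀ (M : Fin (d + 1) → ℕ), (∀ i, 1 ≤ M i) →
      ∀ (emb : ↥(boxDom M) → ↥(Box d ℓ k M)) (Γ : ↥(boxDom M) → ↥(Box d ℓ k M) → List ↥(Box d ℓ k M)),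
        (∀ y x, blkWt ((ℓ + 1) ^ k) M (fun i => (ℓ + 1) ^ k * M i) y x ≠ 0 → pathEnd (emb y) (Γ y x) = x) →
      ∀ (A₀ : Fin (d + 1) → ℝ) (A' : ↥(Box d ℓ k M) → ↥(Box d ℓ k M) → ℝ) (θ θ' τ : ℝ),
        IsUnit (opA d F κ ℓ k a m2 M emb Γ (constBond A₀ Subtype.val + A')).det →
        0 ≤ θ → (∀ x y : ↥(Box d ℓ k M), y.1 ∈ nbrs x.1 → |κ * A' x y| ≤ θ / ((ℓ + 1) ^ k : ℕ)) →
        0 ≤ θ' → (∀ (x z y : ↥(Box d ℓ k M)) (μ : Fin (d + 1)), z.1 = x.1 + e1 μ → y.1 = z.1 + e1 μ →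
          |κ * (A' y z - A' z x)| ≤ θ' / (((ℓ + 1) ^ k : ℕ) : ℝ) ^ 2 ∧
          |κ * (A' x z - A' z y)| ≤ θ' / (((ℓ + 1) ^ k : ℕ) : ℝ) ^ 2) →
        (∀ (x y : ↥(Box d ℓ k M)) (μ : Fin (d + 1)), y.1 = x.1 + e1 μ →
          (x.1 - e1 μ ∉ Box d ℓ k M ∨ y.1 + e1 μ ∉ Box d ℓ k M) → A' x y = 0 ∧ A' y x = 0) →
        0 ≤ τ → (∀ y x, blkWt ((ℓ + 1) ^ k) M (fun i => (ℓ + 1) ^ k * M i) y x ≠ 0 →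
          |κ * lsum A' (emb y) (Γ y x)| ≤ τ) →
        ((d : ℝ) + 2) * c * (((d : ℝ) + 1) * ℓ₁ * (θ + θ') + ((d : ℝ) + 1) * ℓ₁ * θ
          + ((d : ℝ) + 1) * ℓ₁ ^ 2 * θ ^ 2 + B1.aSeq a ((ℓ : ℝ) + 1) k * (ℓ₁ * τ * (2 + ℓ₁ * τ))) ≤ 1 / 2 →
        ∀ (p p' : ℝ), p.HolderConjugate p' → p₁ ≤ p →
        ∀ f : ↥(Box d ℓ k M) × ι → ℝ,
          (∀ μ : Fin (d + 1),
            supN ((greenA d F κ ℓ k a m2 M emb Γ (constBond A₀ Subtype.val + A')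
                * (derivA0 d F κ ℓ k M A₀ μ)ᵀ) *ᵥ f) ≤ 2 * (C * (vol d ℓ k ^ p⁻¹)⁻¹) * lpM p f) ∧
          ∀ μ : Fin (d + 1),
            supN ((greenA d F κ ℓ k a m2 M emb Γ (constBond A₀ Subtype.val + A')
                * (derivA d F κ ℓ k M (constBond A₀ Subtype.val + A') μ)ᵀ) *ᵥ f)
              ≤ (1 + ℓ₁ * θ) * (2 * (C * (vol d ℓ k ^ p⁻¹)⁻¹)) * lpM p f := by
  obtain ⟨c, hc, h⟩ := lemma22_17_pq_box_dual_sup F hℓ₁ hLip κ d ℓ hℓ amin aplus m2plus ha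
  obtain ⟨C, hC, hz⟩ := zero_box_pq_eta ι d ℓ hℓ amin aplus m2plus ha hp₁
  refine ⟨c, hc, C, hC, ?_⟩
  intro k hk a m2 e1' e2 e3 e4 M hM emb Γ hend A₀ A' θ θ' τ hunit hθ hA' hθ' hder hbd hτ0 hτ hsm p p' hpc hp f
  have hpd : (1 : ℝ)⁻¹ - p'⁻¹ = p⁻¹ := by
    have := hpc.inv_add_inv_eq_inv
    rw [inv_one] at this
    rw [inv_one]
    linarith
  have hp0 : 0 < p := by linarith [hpc.lt]
  have hσ : (1 : ℝ)⁻¹ - p'⁻¹ ≤ p₁⁻¹ := by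
    rw [hpd]
    exact (inv_le_inv₀ hp0 (by linarith)).2 hp
  obtain ⟨hz0, hzD⟩ := hz k hk a m2 e1' e2 e3 e4 M hM 1 p' le_rfl hpc.symm.lt.le hσ
  rw [hpd] at hz0 hzD
  have hC' : 0 ≤ C * (vol d ℓ k ^ p⁻¹)⁻¹ :=
    mul_nonneg hC.le (inv_nonneg.2 (Real.rpow_nonneg (vol_pos d ℓ k).le _))
  exact h k hk a m2 e1' e2 e3 e4 M hM emb Γ hend A₀ A' θ θ' τ hunit hθ hA' hθ' hder hbd hτ0 hτ hsm p p' hpc _ hC'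
    hz0 hzD f

/-- **B4 LEMMA 2.2 (2.17) IN THE PRINTED `η`-WEIGHTED NORMS, THIRD MEMBER, THE EDGE `p = 1 < q ≤ p₁'`, THE CONSTANT
INDEPENDENT OF `η`**: `‖G(D^η_{A₀,μ})ᵀf‖_{q,η} ≤ 2C‖f‖_{1,η}`, `‖G(D^η_{Ã,μ})ᵀf‖_{q,η} ≤ (1+ℓθ)2C‖f‖_{1,η}`
(`lemma22_17_pq_box_dual_one_eta`, `lpW_le_of_lpM`, `B4Lemma22LpStair.lpM_one`).
[cite: Balaban1983RegularityDecay, Lemma 2.2 (2.17) p. 578; p. 583] -/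
theorem lemma22_17_weighted_box_dual_one (F : OrthFlow ι) {ℓ₁ : ℝ} (hℓ₁ : 0 ≤ ℓ₁)
    (hLip : ∀ t (v : ι → ℝ), ((F.U t - 1) *ᵥ v) ⬝ᵥ ((F.U t - 1) *ᵥ v) ≤ (ℓ₁ * t) ^ 2 * (v ⬝ᵥ v))
    (κ : ℝ) (d ℓ : ℕ) (hℓ : 1 ≤ ℓ) (amin aplus m2plus : ℝ) (ha : 0 < amin) {p₁ : ℝ} (hp₁ : (d : ℝ) + 1 < p₁) :
    ∃ c : ℝ, 0 < c ∧ ∃ C : ℝ, 0 < C ∧ ∀ (k : ℕ), 1 ≤ k → ∀ (a m2 : ℝ), amin ≤ a → a ≤ aplus → 0 ≤ m2 →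
      m2 ≤ m2plus → ∀ (M : Fin (d + 1) → ℕ), (∀ i, 1 ≤ M i) →
      ∀ (emb : ↥(boxDom M) → ↥(Box d ℓ k M)) (Γ : ↥(boxDom M) → ↥(Box d ℓ k M) → List ↥(Box d ℓ k M)),
        (∀ y x, blkWt ((ℓ + 1) ^ k) M (fun i => (ℓ + 1) ^ k * M i) y x ≠ 0 → pathEnd (emb y) (Γ y x) = x) →
      ∀ (A₀ : Fin (d + 1) → ℝ) (A' : ↥(Box d ℓ k M) → ↥(Box d ℓ k M) → ℝ) (θ θ' τ : ℝ),
        IsUnit (opA d F κ ℓ k a m2 M emb Γ (constBond A₀ Subtype.val + A')).det →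
        0 ≤ θ → (∀ x y : ↥(Box d ℓ k M), y.1 ∈ nbrs x.1 → |κ * A' x y| ≤ θ / ((ℓ + 1) ^ k : ℕ)) →
        0 ≤ θ' → (∀ (x z y : ↥(Box d ℓ k M)) (μ : Fin (d + 1)), z.1 = x.1 + e1 μ → y.1 = z.1 + e1 μ →
          |κ * (A' y z - A' z x)| ≤ θ' / (((ℓ + 1) ^ k : ℕ) : ℝ) ^ 2 ∧
          |κ * (A' x z - A' z y)| ≤ θ' / (((ℓ + 1) ^ k : ℕ) : ℝ) ^ 2) →
        (∀ (x y : ↥(Box d ℓ k M)) (μ : Fin (d + 1)), y.1 = x.1 + e1 μ →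
          (x.1 - e1 μ ∉ Box d ℓ k M ∨ y.1 + e1 μ ∉ Box d ℓ k M) → A' x y = 0 ∧ A' y x = 0) →
        0 ≤ τ → (∀ y x, blkWt ((ℓ + 1) ^ k) M (fun i => (ℓ + 1) ^ k * M i) y x ≠ 0 →
          |κ * lsum A' (emb y) (Γ y x)| ≤ τ) →
        ((d : ℝ) + 2) * c * (((d : ℝ) + 1) * ℓ₁ * (θ + θ') + ((d : ℝ) + 1) * ℓ₁ * θ
          + ((d : ℝ) + 1) * ℓ₁ ^ 2 * θ ^ 2 + B1.aSeq a ((ℓ : ℝ) + 1) k * (ℓ₁ * τ * (2 + ℓ₁ * τ))) ≤ 1 / 2 →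
        ∀ (q q' : ℝ), q.HolderConjugate q' → p₁ ≤ q' →
        ∀ f : ↥(Box d ℓ k M) × ι → ℝ,
          (∀ μ : Fin (d + 1),
            lpW d ℓ k q ((greenA d F κ ℓ k a m2 M emb Γ (constBond A₀ Subtype.val + A')
                * (derivA0 d F κ ℓ k M A₀ μ)ᵀ) *ᵥ f) ≤ 2 * C * lpW d ℓ k 1 f) ∧
          ∀ μ : Fin (d + 1),
            lpW d ℓ k q ((greenA d F κ ℓ k a m2 M emb Γ (constBond A₀ Subtype.val + A')
                * (derivA d F κ ℓ k M (constBond A₀ Subtype.val + A') μ)ᵀ) *ᵥ f)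
              ≤ (1 + ℓ₁ * θ) * (2 * C) * lpW d ℓ k 1 f := by
  obtain ⟨c, hc, C, hC, h⟩ := lemma22_17_pq_box_dual_one_eta F hℓ₁ hLip κ d ℓ hℓ amin aplus m2plus ha hp₁
  refine ⟨c, hc, C, hC, ?_⟩
  intro k hk a m2 e1' e2 e3 e4 M hM emb Γ hend A₀ A' θ θ' τ hunit hθ hA' hθ' hder hbd hτ0 hτ hsm q q' hqc hq' f
  obtain ⟨h1, h2⟩ := h k hk a m2 e1' e2 e3 e4 M hM emb Γ hend A₀ A' θ θ' τ hunit hθ hA' hθ' hder hbd hτ0 hτ hsm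
    q q' hqc hq' f
  have hqd : q'⁻¹ = (1 : ℝ)⁻¹ - q⁻¹ := by
    have := hqc.inv_add_inv_eq_inv
    rw [inv_one] at this
    rw [inv_one]
    linarith
  rw [hqd, ← lpM_one] at h1 h2
  exact ⟨fun μ => lpW_le_of_lpM (by linarith [h1 μ]), fun μ => lpW_le_of_lpM (by linarith [h2 μ])⟩

/-- **B4 LEMMA 2.2 (2.17) IN THE PRINTED SCALING, THIRD MEMBER, THE EDGE `q = ∞`, `p₁ ≤ p < ∞`, THE CONSTANT
INDEPENDENT OF `η`**: `‖G(D^η_{A₀,μ})ᵀf‖_∞ ≤ 2C‖f‖_{p,η}`, `‖G(D^η_{Ã,μ})ᵀf‖_∞ ≤ (1+ℓθ)2C‖f‖_{p,η}`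
(`lemma22_17_pq_box_dual_sup_eta`, `supN_le_lpW_of`) — the third operator of «the operators G_k(□), ∂^η_μG_k(□),
G_k(□)∂^{η*}_μ are bounded operators from L^{p₁}(□) with p₁ > d to L^∞(□)», here for `G_k(□,Ã)`.
[cite: Balaban1983RegularityDecay, Lemma 2.2 (2.17) p. 578; (2.40)–(2.41) p. 583] -/
theorem lemma22_17_weighted_box_dual_sup (F : OrthFlow ι) {ℓ₁ : ℝ} (hℓ₁ : 0 ≤ ℓ₁)
    (hLip : ∀ t (v : ι → ℝ), ((F.U t - 1) *ᵥ v) ⬝ᵥ ((F.U t - 1) *ᵥ v) ≤ (ℓ₁ * t) ^ 2 * (v ⬝ᵥ v))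
    (κ : ℝ) (d ℓ : ℕ) (hℓ : 1 ≤ ℓ) (amin aplus m2plus : ℝ) (ha : 0 < amin) {p₁ : ℝ} (hp₁ : (d : ℝ) + 1 < p₁) :
    ∃ c : ℝ, 0 < c ∧ ∃ C : ℝ, 0 < C ∧ ∀ (k : ℕ), 1 ≤ k → ∀ (a m2 : ℝ), amin ≤ a → a ≤ aplus → 0 ≤ m2 →
      m2 ≤ m2plus → ∀ (M : Fin (d + 1) → ℕ), (∀ i, 1 ≤ M i) →
      ∀ (emb : ↥(boxDom M) → ↥(Box d ℓ k M)) (Γ : ↥(boxDom M) → ↥(Box d ℓ k M) → List ↥(Box d ℓ k M)),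
        (∀ y x, blkWt ((ℓ + 1) ^ k) M (fun i => (ℓ + 1) ^ k * M i) y x ≠ 0 → pathEnd (emb y) (Γ y x) = x) →
      ∀ (A₀ : Fin (d + 1) → ℝ) (A' : ↥(Box d ℓ k M) → ↥(Box d ℓ k M) → ℝ) (θ θ' τ : ℝ),
        IsUnit (opA d F κ ℓ k a m2 M emb Γ (constBond A₀ Subtype.val + A')).det →
        0 ≤ θ → (∀ x y : ↥(Box d ℓ k M), y.1 ∈ nbrs x.1 → |κ * A' x y| ≤ θ / ((ℓ + 1) ^ k : ℕ)) →
        0 ≤ θ' → (∀ (x z y : ↥(Box d ℓ k M)) (μ : Fin (d + 1)), z.1 = x.1 + e1 μ → y.1 = z.1 + e1 μ →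
          |κ * (A' y z - A' z x)| ≤ θ' / (((ℓ + 1) ^ k : ℕ) : ℝ) ^ 2 ∧
          |κ * (A' x z - A' z y)| ≤ θ' / (((ℓ + 1) ^ k : ℕ) : ℝ) ^ 2) →
        (∀ (x y : ↥(Box d ℓ k M)) (μ : Fin (d + 1)), y.1 = x.1 + e1 μ →
          (x.1 - e1 μ ∉ Box d ℓ k M ∨ y.1 + e1 μ ∉ Box d ℓ k M) → A' x y = 0 ∧ A' y x = 0) →
        0 ≤ τ → (∀ y x, blkWt ((ℓ + 1) ^ k) M (fun i => (ℓ + 1) ^ k * M i) y x ≠ 0 →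
          |κ * lsum A' (emb y) (Γ y x)| ≤ τ) →
        ((d : ℝ) + 2) * c * (((d : ℝ) + 1) * ℓ₁ * (θ + θ') + ((d : ℝ) + 1) * ℓ₁ * θ
          + ((d : ℝ) + 1) * ℓ₁ ^ 2 * θ ^ 2 + B1.aSeq a ((ℓ : ℝ) + 1) k * (ℓ₁ * τ * (2 + ℓ₁ * τ))) ≤ 1 / 2 →
        ∀ (p p' : ℝ), p.HolderConjugate p' → p₁ ≤ p →
        ∀ f : ↥(Box d ℓ k M) × ι → ℝ,
          (∀ μ : Fin (d + 1),
            supN ((greenA d F κ ℓ k a m2 M emb Γ (constBond A₀ Subtype.val + A')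
                * (derivA0 d F κ ℓ k M A₀ μ)ᵀ) *ᵥ f) ≤ 2 * C * lpW d ℓ k p f) ∧
          ∀ μ : Fin (d + 1),
            supN ((greenA d F κ ℓ k a m2 M emb Γ (constBond A₀ Subtype.val + A')
                * (derivA d F κ ℓ k M (constBond A₀ Subtype.val + A') μ)ᵀ) *ᵥ f)
              ≤ (1 + ℓ₁ * θ) * (2 * C) * lpW d ℓ k p f := by
  obtain ⟨c, hc, C, hC, h⟩ := lemma22_17_pq_box_dual_sup_eta F hℓ₁ hLip κ d ℓ hℓ amin aplus m2plus ha hp₁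
  refine ⟨c, hc, C, hC, ?_⟩
  intro k hk a m2 e1' e2 e3 e4 M hM emb Γ hend A₀ A' θ θ' τ hunit hθ hA' hθ' hder hbd hτ0 hτ hsm p p' hpc hp f
  obtain ⟨h1, h2⟩ := h k hk a m2 e1' e2 e3 e4 M hM emb Γ hend A₀ A' θ θ' τ hunit hθ hA' hθ' hder hbd hτ0 hτ hsm
    p p' hpc hp f
  exact ⟨fun μ => supN_le_lpW_of (by linarith [h1 μ]), fun μ => supN_le_lpW_of (by linarith [h2 μ])⟩

end DualEdges

end

end Literature.MathematicalPhysics.QuantumFieldTheory.Balaban1983to89.B4Lemma22EtaBox
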